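import Literature.Analysis.FluidPDE.NewtonTestPotential
import Literature.Analysis.FluidPDE.StokesWholeSpacePressure
import HarnessLib

/-!
# Very weak `L³` solutions with the Riesz pressure are distributional solutions

Analysis/FluidPDE proof file in the DAG below the named fact
`Literature.Analysis.FluidPDE.kato_distributional_slab` (**D** of `KatoLocalLerayPressure.lean`:
a Kato solution solves the Navier–Stokes equations in the sense of distributions on the open slab
`(0, S) × ℝ³` with the Riesz pressure `p ∈ L^{3/2}`). In print (Lemarié-Rieusset 2016, Ch. 6,
file pp. 126–136 of the held copy) the passage from the *very weak* (divergence-free-tested,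
pressure-free) equations to the pressure-explicit system (6.13) is: `H = -∂ₜu + νΔu - div(u ⊗ u)`
is curl free, hence a gradient `∇p` (Lemma 6.3, de Rham in `𝒟'((0,T) × ℝ³)`), and for
`u ∈ L²((0,T), L²((1+|x|)⁻⁴dx))` the solution is an *Oseen solution*,
`∇p = -(Id - ℙ) div(u ⊗ u)` (Prop. 6.5 with Def. 6.9 and Lemma 6.4 (B): a divergence-free,
curl-free tempered field vanishing at infinity is zero), i.e. `p` is the Riesz pressure
`Σᵢⱼ ℛᵢℛⱼ(uᵢuⱼ)`, `-Δp = Σᵢⱼ ∂ᵢ∂ⱼ(uᵢuⱼ)`. This file proves the corresponding statement over the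
tree's notions, **with compactly supported objects only** (no tempered distributions, no Leray
projection on `L^p`):

* `isDistributionalNSSolutionOn_slab_of_veryWeak` — let `u ∈ L³((0,S) × ℝ³)`,
  `p ∈ L^{3/2}((0,S) × ℝ³)`; assume on the open slab `Q = (0,S) × ℝ³` that `u` is weakly
  divergence free (`∫∫_Q ⟪u, ∇θ⟫ = 0`), that `p` solves the weak pressure Poisson equation
  `∫∫_Q p Δθ = -∫∫_Q D²θ(u, u)` for all `θ ∈ C_c^∞(Q)` (this is what "`p` is the Riesz pressure
  of `u ⊗ u`" means slice-wise), and that the very weak momentum equation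
  `∫∫_Q ⟪u, ∂ₜψ⟫ + ⟪u, (u·∇)ψ⟫ + ν⟪u, Δψ⟫ = 0` holds for all test fields `ψ ∈ C_c^∞(Q; ℝ³)` with
  divergence-free slices. Then `(u, p)` is a distributional solution on `Q`
  (`IsDistributionalNSSolutionOn`, Caffarelli–Kohn–Nirenberg (2.1)–(2.5)).

## The argument (a compactly supported Helmholtz splitting of the test field)

Given a test field `ψ` on `Q` and a scale `r > 0`, let `N = newtonNearPotential (r/2) r` be the
tree's *truncated* Newtonian potential and `Λ = newtonFarSmoothing (r/2) r` its smoothing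
remainder (`FluidPDE/NewtonLocalPotential`: `ΔN[g] = g - Λ[g]`, `Λ[g] = λ_{r/2,r} ⋆ g` with a smooth
kernel supported in `|z| ≤ r` and `sup|λ_{r/2,r}| = O(r⁻³)`). Put

  `w_r = ψ - ∇N[div ψ] - e_r[ψ]`,  `e_r[ψ] = Σᵢ Λ[⟪bᵢ, ψ⟫] bᵢ = λ_{r/2,r} ⋆ ψ`

(`correctedTestField`, `farSmoothingField`). Then `div w_r = div ψ - (div ψ - Λ[div ψ]) -
Λ[div ψ] = 0` and `w_r ∈ C_c^∞(Q; ℝ³)` (all three pieces act in `x` only and keep the time support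
of `ψ`), so the very weak equation applies to `w_r`. The gradient part contributes
`∫∫ ⟪u, ∂ₜ∇N⟫ + ⟪u, (u·∇)∇N⟫ + ν⟪u, Δ∇N⟫ = 0 + ∫∫ D²N(u,u) + 0 = -∫∫ p ΔN[div ψ]
= -∫∫ p div ψ + ∫∫ p Λ[div ψ]` (`∂ₜ∇ = ∇∂ₜ`, `Δ∇ = ∇Δ` pair to zero with the weakly
divergence-free `u`; the weak Poisson equation), whence for every `r > 0`

  `∫∫_Q W(ψ) + p div ψ = ∫∫_Q p Λ_r[div ψ] + ∫∫_Q W(e_r[ψ])`,  `W` the very weak integrand.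

The right-hand side is `O(r⁻¹)`: every remainder is a function of `L^q(Q)` (`q = 3/2` for `p` and
`|u|²`, `q = 3` for `u`) against a field of size `O(r⁻³)` supported in a box
`[a, b] × B̄(0, R₀ + r)` of volume `O(r³)`, and Hölder gives `O(r⁻³ · r^{3/q'})` with `q' > 1`
(`tendsto_setIntegral_slab_of_bound`). Letting `r → ∞` yields the pressure-explicit identity.
For the corrector this uses `∂ₜe_r[ψ] = e_r[∂ₜψ]` (differentiation under the integral),
`Δe_r[ψ] = e_r[Δψ]`, `div e_r[ψ] = Λ[div ψ]` and
`⟪v, De_r[ψ] v⟫ = Σᵢⱼ ⟪bᵢ,v⟫⟪bⱼ,v⟫ Λ[⟪bᵢ, ∂ⱼψ⟫]`.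

## Contents (all proved; three small definitions)

* slicewise calculus of `Λ[θ(t,·)]` for space–time test functions: `∂ₜ`, `Δ`, linearity, the
  uniform bound `|Λ_{r/2,r}[θ(t,·)]| ≤ C/r³` (`exists_abs_newtonFarSmoothing_slice_le`), supports;
* test-function bookkeeping on the open slab (`IsSpaceTimeTestOn.of_time_support_subset`,
  `.newtonNearPotential_slab`, `.newtonFarSmoothing_slab`, algebra of test fields);
* `farSmoothingField` (the corrector) and its divergence / Laplacian / time derivative /
  convective pairing; `correctedTestField` and its divergence-freeness;
* integrability of the very weak terms on `Q` for `u, |u|² ∈ L¹_loc(Q)`; `veryWeakIntegrand`;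
* the vanishing lemma `tendsto_setIntegral_slab_of_bound` and the two remainder limits;
* the main theorem.

## Mathlib / tree search

Tree (all used): `newtonNearPotential`, `newtonFarSmoothing`, `laplacian_newtonNearPotential`,
`fderiv_newtonFarSmoothing_apply`, `contDiff_newtonFarSmoothing` (`NewtonLocalPotential`);
`contDiff_uncurry_newtonNearPotential_slice`, `contDiff_uncurry_newtonFarSmoothing_slice`,
`tsupport_uncurry_slice_subset_image` (`NewtonTestPotential`);
`exists_forall_abs_newtonFarLaplacian_half_le`, `abs_newtonFarSmoothing_half_le`
(`StokesWholeSpacePressure`); `inner_fderiv_gradient_apply`, `laplacian_gradient`,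
`IsSpaceTimeTestOn.timeDeriv_gradient`, `.timeDeriv_isSpaceTimeTestOn`,
`.laplacian_isSpaceTimeTestOn`, `.gradient_isSpaceTimeTestOn` (`DistributionalPressurePoisson`, whose
`integral_hessian_add_pressure_laplacian_eq_zero` is the converse computation);
`integrable_inner_of_locallyIntegrableOn`, `integrable_mul_of_locallyIntegrableOn`,
`IsSpaceTimeTestOn.continuous_divergence_field` (`SuitableWeakPressure`); `divergence_gradient`,
`divergence_sub_apply` (`PressurePoisson`); `laplacian_integral_mul_comp_sub` (`HarmonicProbe`);
`fderiv_inner_const_left_apply` (`WeakGradientIBP`). `lean search 'IsSpaceTimeTestOn.sub|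
exists_time_support_Ioo|divergence_isSpaceTimeTestOn'`: the time-support lemma exists in
`ForwardMildWeak.lean` (`IsSpaceTimeTestOn.exists_time_support_Ioo`) and is re-derived here
(`…_Ioo_slab`, ten lines) to keep the import closure at the Newton-potential files; no tree lemma
turns very weak whole-space solutions into distributional ones (the torus analogue is
`Torus.IsWeakNSSolutionOn.isDistributionalNSSolutionOn_of_pressure`, `DuchonRobertPressure.lean`,
with the exact `Δ⁻¹` of the torus). Mathlib: `hasDerivAt_integral_of_dominated_loc_of_deriv_le`,
`ContDiffAt.laplacian_add/sub`, `ContDiffAt.laplacian_CLM_comp_left`,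
`ENNReal.lintegral_mul_le_Lp_mul_Lq`, `Measure.addHaar_closedBall`, `tendsto_rpow_neg_atTop`,
`norm_integral_le_lintegral_norm`, `MemLp.locallyIntegrable`,
`locallyIntegrableOn_of_locallyIntegrable_restrict`.

## References

* P. G. Lemarié-Rieusset, *The Navier–Stokes Problem in the 21st Century*, CRC Press 2016,
  doi:10.1201/b19556 (file pages of the held copy): Def. 6.2 and Lemma 6.3 (p. 126), Prop. 6.2
  (p. 130), Lemma 6.4 (p. 133), (6.13) (p. 135), Prop. 6.5 and Def. 6.9 (p. 136).
  [LemarieRieusset2016]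
* L. Caffarelli, R. Kohn, L. Nirenberg, CPAM 35 (1982), (2.1)–(2.5). [CaffarelliKohnNirenberg1982]
* D. Gilbarg, N. S. Trudinger, *Elliptic PDE of second order* (2001), (2.16)–(2.17) (Green's
  representation with a cut-off kernel). [GilbargTrudinger2001]
-/

noncomputable section

open MeasureTheory Set Function Filter Topology TopologicalSpace InnerProductSpace Metric
open scoped Laplacian RealInnerProductSpace NNReal ENNReal ContDiff

namespace Literature.Analysis.FluidPDE

/-- Local notation for physical space `ℝ³ = EuclideanSpace ℝ (Fin 3)`. -/
local notation "ℝ³" => EuclideanSpace ℝ (Fin 3)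

/-- Local notation for the standard orthonormal frame of `ℝ³`. -/
local notation "𝐛" => EuclideanSpace.basisFun (Fin 3) ℝ

/-! ### Slicewise smoothing remainder `Λ[θ(t,·)]` of a space–time test function: calculus -/

section FarSmoothingSlice

variable {r₀ r₁ : ℝ}

/-- **`∂ₜ Λ[θ(t,·)](x) = Λ[∂ₜθ(t,·)](x)`** for a space–time test function `θ` and an integrable
kernel: differentiation under the integral sign (domination by `|λ| · sup|∂ₜθ|`). [folklore] -/
theorem hasDerivAt_integral_mul_slice_comp_sub {k : ℝ³ → ℝ} (hk : Integrable k)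
    {θ : ℝ → ℝ³ → ℝ} (hθ : IsSpaceTimeTestOn (⊤ : Opens (ℝ × ℝ³)) θ) (t : ℝ) (x : ℝ³) :
    HasDerivAt (fun s => ∫ z, k z * θ s (x - z)) (∫ z, k z * timeDeriv θ t (x - z)) t := by
  have hθ' := hθ.timeDeriv_top
  obtain ⟨M, hM0, hM⟩ := hθ'.exists_norm_le
  obtain ⟨M₀, -, hM₀⟩ := hθ.exists_norm_le
  have hcont : ∀ s, Continuous fun z : ℝ³ => θ s (x - z) := fun s =>
    (hθ.contDiff.continuous.comp (continuous_const.prodMk (continuous_const.sub continuous_id)))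
  have hcont' : ∀ s, Continuous fun z : ℝ³ => timeDeriv θ s (x - z) := fun s =>
    (hθ'.contDiff.continuous.comp (continuous_const.prodMk (continuous_const.sub continuous_id)))
  have hmeas : ∀ s, AEStronglyMeasurable (fun z => k z * θ s (x - z)) volume := fun s =>
    hk.aestronglyMeasurable.mul (hcont s).aestronglyMeasurable
  have h := hasDerivAt_integral_of_dominated_loc_of_deriv_le (μ := (volume : Measure ℝ³))
    (F := fun s z => k z * θ s (x - z)) (F' := fun s z => k z * timeDeriv θ s (x - z))
    (x₀ := t) (bound := fun z => ‖k z‖ * M) (s := univ) univ_mem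
    (Eventually.of_forall hmeas) ?_ ?_ ?_ (hk.norm.mul_const M) ?_
  · exact h.2
  · refine Integrable.mono' (hk.norm.mul_const M₀) (hmeas t) (Eventually.of_forall fun z => ?_)
    rw [norm_mul]
    exact mul_le_mul_of_nonneg_left (hM₀ _ _) (norm_nonneg _)
  · exact hk.aestronglyMeasurable.mul (hcont' t).aestronglyMeasurable
  · refine Eventually.of_forall fun z s _ => ?_
    rw [norm_mul]
    exact mul_le_mul_of_nonneg_left (hM _ _) (norm_nonneg _)
  · exact Eventually.of_forall fun z s _ => (hθ.hasDerivAt_time s (x - z)).const_mul (k z)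

/-- **`∂ₜ Λ[θ(t,·)] = Λ[∂ₜθ(t,·)]`** for the smoothing remainder `Λ = newtonFarSmoothing r₀ r₁`,
`0 < r₀ < r₁`, of a space–time test function. [folklore] -/
theorem timeDeriv_newtonFarSmoothing_slice (h₀ : 0 < r₀) (h₁ : r₀ < r₁) {θ : ℝ → ℝ³ → ℝ}
    (hθ : IsSpaceTimeTestOn (⊤ : Opens (ℝ × ℝ³)) θ) (t : ℝ) (x : ℝ³) :
    timeDeriv (fun s y => newtonFarSmoothing r₀ r₁ (θ s) y) t x =
      newtonFarSmoothing r₀ r₁ (timeDeriv θ t) x := by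
  rw [timeDeriv_apply]
  simp only [newtonFarSmoothing_apply]
  exact (hasDerivAt_integral_mul_slice_comp_sub (integrable_newtonFarLaplacian h₀ h₁) hθ t x).deriv

/-- **`Δ Λ[g] = Λ[Δg]`** for `g ∈ C²` (the Laplacian passes under the integral,
`laplacian_integral_mul_comp_sub`). [folklore] -/
theorem laplacian_newtonFarSmoothing (h₀ : 0 < r₀) (h₁ : r₀ < r₁) {g : ℝ³ → ℝ}
    (hg : ContDiff ℝ 2 g) (x : ℝ³) :
    Δ (newtonFarSmoothing r₀ r₁ g) x = newtonFarSmoothing r₀ r₁ (Δ g) x := by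
  have h := laplacian_integral_mul_comp_sub (integrable_newtonFarLaplacian h₀ h₁)
    (newtonFarLaplacian_eq_zero_of_lt' h₀.le h₁) hg x
  rw [newtonFarSmoothing_apply]
  exact h

/-- Linearity of `Λ`: finite sums (continuous compactly supported kernel, continuous data).
[folklore] -/
theorem newtonFarSmoothing_finset_sum (h₀ : 0 < r₀) (h₁ : r₀ < r₁) {ι : Type*} (s : Finset ι)
    {g : ι → ℝ³ → ℝ} (hg : ∀ i, Continuous (g i)) (x : ℝ³) :
    newtonFarSmoothing r₀ r₁ (fun y => ∑ i ∈ s, g i y) x =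
      ∑ i ∈ s, newtonFarSmoothing r₀ r₁ (g i) x := by
  simp only [newtonFarSmoothing_apply, Finset.mul_sum]
  refine integral_finsetSum s fun i _ => ?_
  exact ((continuous_newtonFarLaplacian h₀ h₁).mul
    ((hg i).comp (continuous_const.sub continuous_id))).integrable_of_hasCompactSupport
    ((hasCompactSupport_newtonFarLaplacian h₀.le h₁).mul_right)

/-- Linearity of `Λ`: scalar multiples. [folklore] -/
theorem newtonFarSmoothing_const_mul (r₀ r₁ c : ℝ) (g : ℝ³ → ℝ) (x : ℝ³) :
    newtonFarSmoothing r₀ r₁ (fun y => c * g y) x = c * newtonFarSmoothing r₀ r₁ g x := by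
  simp only [newtonFarSmoothing_apply, ← integral_const_mul]
  exact integral_congr_ae (Eventually.of_forall fun z => by ring)

/-- **Uniform `O(r⁻³)` sup bound for the slicewise smoothing remainder of a space–time test
function at scale `r`:** `|Λ_{r/2,r}[θ(t,·)](x)| ≤ C/r³` for all `t`, `x`, `r > 0`
(`|λ_{r/2,r}| ≤ S/r³` and `∫|θ(t,·)| ≤ sup|θ| · vol K`, `K` a compact set carrying all slices).
[folklore] -/
theorem exists_abs_newtonFarSmoothing_slice_le {θ : ℝ → ℝ³ → ℝ}
    (hθ : IsSpaceTimeTestOn (⊤ : Opens (ℝ × ℝ³)) θ) :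
    ∃ C : ℝ, 0 ≤ C ∧ ∀ ⦃r : ℝ⦄, 0 < r → ∀ t x,
      |newtonFarSmoothing (r / 2) r (θ t) x| ≤ C / r ^ 3 := by
  obtain ⟨S, hS0, hS⟩ := exists_forall_abs_newtonFarLaplacian_half_le
  obtain ⟨M, hM0, hM⟩ := hθ.exists_norm_le
  obtain ⟨K, hK, hKt⟩ := hθ.exists_compact_slice_subset
  have hvol : volume K < (⊤ : ℝ≥0∞) := hK.measure_lt_top
  set V : ℝ := (volume K).toReal with hV
  have hint : ∀ t, Integrable (θ t) := fun t =>
    (hθ.contDiff_slice t).continuous.integrable_of_hasCompactSupport (hθ.hasCompactSupport_slice t)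
  have hL1 : ∀ t, ∫ z, |θ t z| ≤ M * V := by
    intro t
    have hsupp : support (fun z => |θ t z|) ⊆ K := fun z hz => by
      rw [mem_support, ne_eq, abs_eq_zero] at hz
      exact hKt t (subset_tsupport _ hz)
    calc ∫ z, |θ t z| = ∫ z in K, |θ t z| :=
          (setIntegral_eq_integral_of_forall_compl_eq_zero fun z hz =>
            notMem_support.1 fun h => hz (hsupp h)).symm
      _ ≤ ∫ _ in K, M := by
          refine setIntegral_mono_on (hint t).abs.integrableOn ?_ hK.measurableSet fun z _ => ?_
          · exact integrableOn_const (hs := hvol.ne) (hC := by simp)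
          · rw [← Real.norm_eq_abs]; exact hM t z
      _ = M * V := by
          rw [setIntegral_const, smul_eq_mul, mul_comm, hV, Measure.real]
  refine ⟨S * (M * V), by positivity, fun r hr t x => ?_⟩
  calc |newtonFarSmoothing (r / 2) r (θ t) x| ≤ S / r ^ 3 * ∫ z, |θ t z| :=
        abs_newtonFarSmoothing_half_le hS hr (hint t) x
    _ ≤ S / r ^ 3 * (M * V) := mul_le_mul_of_nonneg_left (hL1 t) (by positivity)
    _ = S * (M * V) / r ^ 3 := by ring

/-- The slicewise smoothing remainder vanishes far out: if all slices of `θ` vanish off the ball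
of radius `R₀`, then `Λ_{r₀,r₁}[θ(t,·)](x) = 0` for `‖x‖ > R₀ + r₁`. [folklore] -/
theorem newtonFarSmoothing_slice_eq_zero_of_lt_norm (h₀ : 0 ≤ r₀) (h₁ : r₀ < r₁)
    {θ : ℝ → ℝ³ → ℝ} {R₀ : ℝ} (hR : ∀ t y, R₀ < ‖y‖ → θ t y = 0) {t : ℝ} {x : ℝ³}
    (hx : R₀ + r₁ < ‖x‖) : newtonFarSmoothing r₀ r₁ (θ t) x = 0 := by
  refine newtonFarSmoothing_eq_zero_of_forall h₀ h₁ fun z hz => hR t _ ?_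
  have := norm_sub_norm_le x z
  linarith

/-- The slicewise truncated potential vanishes far out (same statement for `N`). [folklore] -/
theorem newtonNearPotential_slice_eq_zero_of_lt_norm (h₀ : 0 ≤ r₀) (h₁ : r₀ < r₁)
    {θ : ℝ → ℝ³ → ℝ} {R₀ : ℝ} (hR : ∀ t y, R₀ < ‖y‖ → θ t y = 0) {t : ℝ} {x : ℝ³}
    (hx : R₀ + r₁ < ‖x‖) : newtonNearPotential r₀ r₁ (θ t) x = 0 := by
  refine newtonNearPotential_eq_zero_of_forall h₀ h₁ fun z hz => hR t _ ?_
  have := norm_sub_norm_le x z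
  linarith

end FarSmoothingSlice

/-! ### Test functions on an open slab: time support, and the slicewise potentials -/

section Slab

variable {F : Type*} [NormedAddCommGroup F] [NormedSpace ℝ F]

/-- A space–time test function on `ℝ × ℝ³` whose slices vanish outside a compact time interval
`[a, b] ⊂ I`, `I` open, is a space–time test function on the open slab `I × ℝ³`. [folklore] -/
theorem IsSpaceTimeTestOn.of_time_support_subset {I : Set ℝ} (hI : IsOpen I) {ψ : ℝ → ℝ³ → F}
    (hψ : IsSpaceTimeTestOn (⊤ : Opens (ℝ × ℝ³)) ψ) {a b : ℝ} (hab : Icc a b ⊆ I)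
    (hsupp : ∀ t, t ∉ Icc a b → ψ t = 0) : IsSpaceTimeTestOn (slab ℝ³ I hI) ψ := by
  refine ⟨hψ.contDiff, hψ.hasCompactSupport, ?_⟩
  have hs : support (uncurry ψ) ⊆ Icc a b ×ˢ (univ : Set ℝ³) := by
    rintro ⟨t, x⟩ hz
    refine ⟨?_, mem_univ _⟩
    by_contra ht
    exact hz (by simp [uncurry, hsupp t ht])
  refine (closure_minimal hs (isClosed_Icc.prod isClosed_univ)).trans ?_
  rw [coe_slab]
  exact prod_mono hab Subset.rfl

/-- A space–time test function on the open slab `(α, β) × ℝ³`, `α < β`, has its time support in a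
compact interval `[a, b]` with `α < a ≤ b < β` (twin of the tree's
`IsSpaceTimeTestOn.exists_time_support_Ioo`, `ForwardMildWeak.lean`, re-derived to keep the
import closure small). [folklore] -/
theorem IsSpaceTimeTestOn.exists_time_support_Ioo_slab {α β : ℝ} (hαβ : α < β)
    {ψ : ℝ → ℝ³ → F} (hψ : IsSpaceTimeTestOn (slab ℝ³ (Ioo α β) isOpen_Ioo) ψ) :
    ∃ a b : ℝ, α < a ∧ a ≤ b ∧ b < β ∧ ∀ t, t ∉ Icc a b → ψ t = 0 := by
  rcases (tsupport (uncurry ψ)).eq_empty_or_nonempty with h0 | hne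
  · have hz : uncurry ψ = 0 := tsupport_eq_empty_iff.1 h0
    refine ⟨(α + β) / 2, (α + β) / 2, by linarith, le_rfl, by linarith,
      fun t _ => funext fun x => ?_⟩
    exact congrFun hz (t, x)
  · have hK : IsCompact (tsupport (uncurry ψ)) := hψ.hasCompactSupport
    obtain ⟨z₁, hz₁, hmax⟩ := hK.exists_isMaxOn hne continuous_fst.continuousOn
    obtain ⟨z₀, hz₀, hmin⟩ := hK.exists_isMinOn hne continuous_fst.continuousOn
    have hb : z₁.1 < β := (mem_slab.1 (hψ.tsupport_subset hz₁)).2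
    have ha : α < z₀.1 := (mem_slab.1 (hψ.tsupport_subset hz₀)).1
    refine ⟨z₀.1, z₁.1, ha, hmin hz₁, hb, fun t ht => funext fun x => ?_⟩
    by_contra hx
    have hmem : (t, x) ∈ tsupport (uncurry ψ) := subset_tsupport _ hx
    exact ht ⟨hmin hmem, hmax hmem⟩

/-- A space–time test field (on any region) vanishes outside a large ball in space, uniformly in
time. [folklore] -/
theorem IsSpaceTimeTestOn.exists_forall_eq_zero_of_lt_norm_slice {Q : Opens (ℝ × ℝ³)}
    {ψ : ℝ → ℝ³ → F} (hψ : IsSpaceTimeTestOn Q ψ) :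
    ∃ R : ℝ, 0 ≤ R ∧ ∀ t z, R < ‖z‖ → ψ t z = 0 := by
  obtain ⟨K, hK, hsub⟩ := hψ.exists_compact_slice_subset
  obtain ⟨R, hR⟩ := hK.isBounded.subset_closedBall (0 : ℝ³)
  refine ⟨max R 0, le_max_right _ _, fun t z hz => ?_⟩
  apply image_eq_zero_of_notMem_tsupport
  intro h
  have h1 := hR (hsub t h)
  rw [mem_closedBall_zero_iff] at h1
  exact absurd (h1.trans (le_max_left R 0)) (not_le.2 hz)

variable {r₀ r₁ S : ℝ} {θ : ℝ → ℝ³ → ℝ}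

/-- **The slicewise truncated potential of a space–time test function is a space–time test
function on `ℝ × ℝ³`** (`0 ≤ r₀ < r₁`; joint smoothness is the tree's
`contDiff_uncurry_newtonNearPotential_slice`, the support grows by `r₁` in space). [folklore] -/
theorem IsSpaceTimeTestOn.newtonNearPotential_top {Q : Opens (ℝ × ℝ³)}
    (hθ : IsSpaceTimeTestOn Q θ) (h₀ : 0 ≤ r₀) (h₁ : r₀ < r₁) :
    IsSpaceTimeTestOn (⊤ : Opens (ℝ × ℝ³)) (fun t => newtonNearPotential r₀ r₁ (θ t)) := by
  have hsub := tsupport_uncurry_slice_subset_image (ρ₁ := r₁) (N := fun t =>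
    newtonNearPotential r₀ r₁ (θ t)) hθ.hasCompactSupport
    (fun t x hx => newtonNearPotential_eq_zero_of_forall h₀ h₁ hx)
  have hΦc : Continuous (fun q : (ℝ × ℝ³) × ℝ³ => ((q.1.1, q.1.2 + q.2) : ℝ × ℝ³)) :=
    (continuous_fst.comp continuous_fst).prodMk
      ((continuous_snd.comp continuous_fst).add continuous_snd)
  exact ⟨contDiff_uncurry_newtonNearPotential_slice hθ h₀ h₁,
    IsCompact.of_isClosed_subset ((hθ.hasCompactSupport.prod (isCompact_closedBall _ _)).image hΦc)
      (isClosed_tsupport _) hsub, fun _ _ => trivial⟩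

/-- The same for the slicewise smoothing remainder `(t, x) ↦ Λ[θ(t,·)](x)` (`0 < r₀ < r₁`).
[folklore] -/
theorem IsSpaceTimeTestOn.newtonFarSmoothing_top {Q : Opens (ℝ × ℝ³)}
    (hθ : IsSpaceTimeTestOn Q θ) (h₀ : 0 < r₀) (h₁ : r₀ < r₁) :
    IsSpaceTimeTestOn (⊤ : Opens (ℝ × ℝ³)) (fun t => newtonFarSmoothing r₀ r₁ (θ t)) := by
  have hsub := tsupport_uncurry_slice_subset_image (ρ₁ := r₁) (N := fun t =>
    newtonFarSmoothing r₀ r₁ (θ t)) hθ.hasCompactSupport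
    (fun t x hx => newtonFarSmoothing_eq_zero_of_forall h₀.le h₁ hx)
  have hΦc : Continuous (fun q : (ℝ × ℝ³) × ℝ³ => ((q.1.1, q.1.2 + q.2) : ℝ × ℝ³)) :=
    (continuous_fst.comp continuous_fst).prodMk
      ((continuous_snd.comp continuous_fst).add continuous_snd)
  exact ⟨contDiff_uncurry_newtonFarSmoothing_slice hθ h₀ h₁,
    IsCompact.of_isClosed_subset ((hθ.hasCompactSupport.prod (isCompact_closedBall _ _)).image hΦc)
      (isClosed_tsupport _) hsub, fun _ _ => trivial⟩

/-- **On the open slab `(0, S) × ℝ³` the slicewise truncated potential of a test function is a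
test function on the same slab** (its time support is that of `θ`). [folklore] -/
theorem IsSpaceTimeTestOn.newtonNearPotential_slab (hS : 0 < S)
    (hθ : IsSpaceTimeTestOn (slab ℝ³ (Ioo 0 S) isOpen_Ioo) θ) (h₀ : 0 ≤ r₀) (h₁ : r₀ < r₁) :
    IsSpaceTimeTestOn (slab ℝ³ (Ioo 0 S) isOpen_Ioo) (fun t => newtonNearPotential r₀ r₁ (θ t)) := by
  obtain ⟨a, b, ha, -, hb, hsupp⟩ := hθ.exists_time_support_Ioo_slab hS
  refine (hθ.newtonNearPotential_top h₀ h₁).of_time_support_subset isOpen_Ioo (a := a) (b := b)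
    (fun t ht => ⟨ha.trans_le ht.1, ht.2.trans_lt hb⟩) fun t ht => ?_
  funext x
  have h0 : θ t = 0 := hsupp t ht
  exact newtonNearPotential_eq_zero_of_forall h₀ h₁ fun z _ => by simp [h0]

/-- The same for the slicewise smoothing remainder on the slab (`0 < r₀ < r₁`). [folklore] -/
theorem IsSpaceTimeTestOn.newtonFarSmoothing_slab (hS : 0 < S)
    (hθ : IsSpaceTimeTestOn (slab ℝ³ (Ioo 0 S) isOpen_Ioo) θ) (h₀ : 0 < r₀) (h₁ : r₀ < r₁) :
    IsSpaceTimeTestOn (slab ℝ³ (Ioo 0 S) isOpen_Ioo) (fun t => newtonFarSmoothing r₀ r₁ (θ t)) := by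
  obtain ⟨a, b, ha, -, hb, hsupp⟩ := hθ.exists_time_support_Ioo_slab hS
  refine (hθ.newtonFarSmoothing_top h₀ h₁).of_time_support_subset isOpen_Ioo (a := a) (b := b)
    (fun t ht => ⟨ha.trans_le ht.1, ht.2.trans_lt hb⟩) fun t ht => ?_
  funext x
  have h0 : θ t = 0 := hsupp t ht
  exact newtonFarSmoothing_eq_zero_of_forall h₀.le h₁ fun z _ => by simp [h0]

end Slab

/-! ### Algebra of space–time test fields on a region -/

section TestAlgebra

variable {E : Type*} [NormedAddCommGroup E] [NormedSpace ℝ E]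
variable {F : Type*} [NormedAddCommGroup F] [NormedSpace ℝ F]
variable {G : Type*} [NormedAddCommGroup G] [NormedSpace ℝ G]
variable {Q : Opens (ℝ × E)}

/-- Sums of space–time test fields on `Q` are space–time test fields on `Q`. [folklore] -/
theorem IsSpaceTimeTestOn.add {ψ₁ ψ₂ : ℝ → E → F} (h₁ : IsSpaceTimeTestOn Q ψ₁)
    (h₂ : IsSpaceTimeTestOn Q ψ₂) : IsSpaceTimeTestOn Q (fun t x => ψ₁ t x + ψ₂ t x) := by
  have e : uncurry (fun t x => ψ₁ t x + ψ₂ t x) = uncurry ψ₁ + uncurry ψ₂ := rfl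
  refine ⟨?_, ?_, ?_⟩
  · rw [e]; exact h₁.contDiff.add h₂.contDiff
  · rw [e]; exact h₁.hasCompactSupport.add h₂.hasCompactSupport
  · rw [e]
    refine (closure_mono (support_add _ _)).trans ?_
    rw [closure_union]
    exact union_subset h₁.tsupport_subset h₂.tsupport_subset

/-- Differences of space–time test fields on `Q` are space–time test fields on `Q`. [folklore] -/
theorem IsSpaceTimeTestOn.sub {ψ₁ ψ₂ : ℝ → E → F} (h₁ : IsSpaceTimeTestOn Q ψ₁)
    (h₂ : IsSpaceTimeTestOn Q ψ₂) : IsSpaceTimeTestOn Q (fun t x => ψ₁ t x - ψ₂ t x) := by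
  have e : uncurry (fun t x => ψ₁ t x - ψ₂ t x) = uncurry ψ₁ - uncurry ψ₂ := rfl
  refine ⟨?_, ?_, ?_⟩
  · rw [e]; exact h₁.contDiff.sub h₂.contDiff
  · rw [e]; exact h₁.hasCompactSupport.sub h₂.hasCompactSupport
  · rw [e]
    refine (closure_mono (support_sub _ _)).trans ?_
    rw [closure_union]
    exact union_subset h₁.tsupport_subset h₂.tsupport_subset

/-- Finite sums of space–time test fields on `Q`. [folklore] -/
theorem IsSpaceTimeTestOn.finsetSum {ι : Type*} (s : Finset ι) {ψ : ι → ℝ → E → F}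
    (h : ∀ i ∈ s, IsSpaceTimeTestOn Q (ψ i)) :
    IsSpaceTimeTestOn Q (fun t x => ∑ i ∈ s, ψ i t x) := by
  classical
  induction s using Finset.induction_on with
  | empty =>
    have e : (fun t x => ∑ i ∈ (∅ : Finset ι), ψ i t x) = (0 : ℝ → E → F) := by
      funext t x; simp
    rw [e]; exact isSpaceTimeTestOn_zero Q
  | insert a s ha ih =>
    have e : (fun t x => ∑ i ∈ insert a s, ψ i t x) =
        fun t x => ψ a t x + ∑ i ∈ s, ψ i t x := by
      funext t x; rw [Finset.sum_insert ha]
    rw [e]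
    exact (h a (Finset.mem_insert_self a s)).add
      (ih fun i hi => h i (Finset.mem_insert_of_mem hi))

/-- Post-composition with a continuous linear map preserves space–time test fields on `Q`
(twin of the tree's `IsSpaceTimeTestOn.clm_comp_left`, `PlanarLiftWeak.lean`). [folklore] -/
theorem IsSpaceTimeTestOn.clm_left {ψ : ℝ → E → F} (hψ : IsSpaceTimeTestOn Q ψ)
    (L : F →L[ℝ] G) : IsSpaceTimeTestOn Q (fun t x => L (ψ t x)) := by
  have e : uncurry (fun t x => L (ψ t x)) = L ∘ uncurry ψ := rfl
  refine ⟨?_, ?_, ?_⟩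
  · rw [e]; exact L.contDiff.comp hψ.contDiff
  · rw [e]; exact hψ.hasCompactSupport.comp_left (map_zero L)
  · rw [e]
    exact (closure_mono (support_comp_subset (map_zero L) _)).trans hψ.tsupport_subset

/-- `(t, x) ↦ θ(t, x) • v` is a space–time test field for a scalar test function `θ`. [folklore] -/
theorem IsSpaceTimeTestOn.smul_const {θ : ℝ → E → ℝ} (hθ : IsSpaceTimeTestOn Q θ) (v : F) :
    IsSpaceTimeTestOn Q (fun t x => θ t x • v) :=
  hθ.clm_left ((ContinuousLinearMap.id ℝ ℝ).smulRight v)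

/-- The time derivative commutes with post-composition by a continuous linear map. [folklore] -/
theorem IsSpaceTimeTestOn.timeDeriv_clm_left {ψ : ℝ → E → F} (hψ : IsSpaceTimeTestOn Q ψ)
    (L : F →L[ℝ] G) (t : ℝ) (x : E) :
    timeDeriv (fun t x => L (ψ t x)) t x = L (timeDeriv ψ t x) := by
  rw [timeDeriv_apply]
  exact (L.hasFDerivAt.comp_hasDerivAt t (hψ.hasDerivAt_time t x)).deriv

/-- The time derivative of a sum of test fields. [folklore] -/
theorem IsSpaceTimeTestOn.timeDeriv_add {ψ₁ ψ₂ : ℝ → E → F} (h₁ : IsSpaceTimeTestOn Q ψ₁)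
    (h₂ : IsSpaceTimeTestOn Q ψ₂) (t : ℝ) (x : E) :
    timeDeriv (fun t x => ψ₁ t x + ψ₂ t x) t x = timeDeriv ψ₁ t x + timeDeriv ψ₂ t x := by
  rw [timeDeriv_apply]
  exact ((h₁.hasDerivAt_time t x).add (h₂.hasDerivAt_time t x)).deriv

/-- The time derivative of a difference of test fields. [folklore] -/
theorem IsSpaceTimeTestOn.timeDeriv_sub {ψ₁ ψ₂ : ℝ → E → F} (h₁ : IsSpaceTimeTestOn Q ψ₁)
    (h₂ : IsSpaceTimeTestOn Q ψ₂) (t : ℝ) (x : E) :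
    timeDeriv (fun t x => ψ₁ t x - ψ₂ t x) t x = timeDeriv ψ₁ t x - timeDeriv ψ₂ t x := by
  rw [timeDeriv_apply]
  exact ((h₁.hasDerivAt_time t x).sub (h₂.hasDerivAt_time t x)).deriv

/-- The time derivative of a finite sum of test fields. [folklore] -/
theorem IsSpaceTimeTestOn.timeDeriv_finsetSum {ι : Type*} (s : Finset ι) {ψ : ι → ℝ → E → F}
    (h : ∀ i ∈ s, IsSpaceTimeTestOn Q (ψ i)) (t : ℝ) (x : E) :
    timeDeriv (fun t x => ∑ i ∈ s, ψ i t x) t x = ∑ i ∈ s, timeDeriv (ψ i) t x := by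
  rw [timeDeriv_apply]
  have : (fun s' => ∑ i ∈ s, ψ i s' x) = ∑ i ∈ s, fun s' => ψ i s' x := by
    funext s'; simp [Finset.sum_apply]
  rw [this, deriv_sum fun i hi => ((h i hi).hasDerivAt_time t x).differentiableAt]
  rfl

end TestAlgebra

/-! ### The divergence corrector `e[χ] = λ ⋆ χ` (componentwise smoothing remainder) -/

section Corrector

variable {r₀ r₁ : ℝ}

/-- **The divergence corrector** `e[χ](x) = Σᵢ Λ[⟪bᵢ, χ⟫](x) bᵢ = (λ ⋆ χ)(x)`: the smoothing
remainder `Λ = newtonFarSmoothing r₀ r₁` applied componentwise to a vector field (in the standard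
frame `bᵢ` of `ℝ³`). Its divergence is `Λ[div χ]`, which is exactly the divergence defect of
`χ - ∇N[div χ]` (`ΔN[g] = g - Λ[g]`). [folklore] -/
def farSmoothingField (r₀ r₁ : ℝ) (χ : ℝ³ → ℝ³) (x : ℝ³) : ℝ³ :=
  ∑ i, newtonFarSmoothing r₀ r₁ (fun y => ⟪𝐛 i, χ y⟫) x • 𝐛 i

/-- Unfolding `farSmoothingField`. [folklore] -/
theorem farSmoothingField_apply (r₀ r₁ : ℝ) (χ : ℝ³ → ℝ³) (x : ℝ³) :
    farSmoothingField r₀ r₁ χ x = ∑ i, newtonFarSmoothing r₀ r₁ (fun y => ⟪𝐛 i, χ y⟫) x • 𝐛 i :=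
  rfl

/-- The components `⟪bᵢ, χ⟫` of a `Cⁿ` field are `Cⁿ`. [folklore] -/
theorem contDiff_inner_const_left {n : WithTop ℕ∞} {χ : ℝ³ → ℝ³} (hχ : ContDiff ℝ n χ) (v : ℝ³) :
    ContDiff ℝ n fun y => ⟪v, χ y⟫ :=
  (innerSL ℝ v).contDiff.comp hχ

/-- `Δ⟪v, χ⟫ = ⟪v, Δχ⟫` for `χ ∈ C²`. [folklore] -/
theorem laplacian_inner_const_left {χ : ℝ³ → ℝ³} (hχ : ContDiff ℝ 2 χ) (v y : ℝ³) :
    Δ (fun y => ⟪v, χ y⟫) y = ⟪v, Δ χ y⟫ := by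
  have h := (hχ.contDiffAt (x := y)).laplacian_CLM_comp_left (l := innerSL ℝ v)
  exact h

/-- `Δ(c • v) = (Δc) • v` for a `C²` scalar function `c` and a constant vector. [folklore] -/
theorem laplacian_smul_const_right {c : ℝ³ → ℝ} (hc : ContDiff ℝ 2 c) (v : ℝ³) (y : ℝ³) :
    Δ (fun y => c y • v) y = (Δ c y) • v := by
  have h := (hc.contDiffAt (x := y)).laplacian_CLM_comp_left
    (l := (ContinuousLinearMap.id ℝ ℝ).smulRight v)
  exact h

/-- The Laplacian of a finite sum of `C²` functions. [folklore] -/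
theorem laplacian_finsetSum_apply {F : Type*} [NormedAddCommGroup F] [NormedSpace ℝ F] {ι : Type*}
    (s : Finset ι) {f : ι → ℝ³ → F} (hf : ∀ i ∈ s, ContDiff ℝ 2 (f i)) (y : ℝ³) :
    Δ (fun y => ∑ i ∈ s, f i y) y = ∑ i ∈ s, Δ (f i) y := by
  classical
  induction s using Finset.induction_on with
  | empty =>
    simp only [Finset.sum_empty]
    change Δ (fun _ : ℝ³ => (0 : F)) y = 0
    rw [InnerProductSpace.laplacian_const]; rfl
  | insert a s ha ih =>
    have e : (fun y => ∑ i ∈ insert a s, f i y) = (f a) + fun y => ∑ i ∈ s, f i y := by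
      funext y; rw [Finset.sum_insert ha]; rfl
    have hs : ContDiff ℝ 2 fun y => ∑ i ∈ s, f i y :=
      ContDiff.sum fun i hi => hf i (Finset.mem_insert_of_mem hi)
    rw [e, Finset.sum_insert ha,
      (hf a (Finset.mem_insert_self a s)).contDiffAt.laplacian_add hs.contDiffAt,
      ih fun i hi => hf i (Finset.mem_insert_of_mem hi)]

/-- **`div e[χ] = Λ[div χ]`** for `χ ∈ C¹` with compact support (`∂ₐΛ[g] = Λ[∂ₐg]`,
orthonormality of the frame, and `div χ = Σⱼ ⟪bⱼ, ∂ⱼχ⟫`). [folklore] -/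
theorem divergence_farSmoothingField (h₀ : 0 < r₀) (h₁ : r₀ < r₁) {χ : ℝ³ → ℝ³}
    (hχ : ContDiff ℝ 1 χ) (x : ℝ³) :
    VectorCalculus.divergence (farSmoothingField r₀ r₁ χ) x =
      newtonFarSmoothing r₀ r₁ (fun y => VectorCalculus.divergence χ y) x := by
  have hci : ∀ i, ContDiff ℝ 1 fun y => ⟪𝐛 i, χ y⟫ := fun i => contDiff_inner_const_left hχ _
  have hΛi : ∀ i, ContDiff ℝ 1 (newtonFarSmoothing r₀ r₁ fun y => ⟪𝐛 i, χ y⟫) := fun i =>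
    contDiff_newtonFarSmoothing h₀ h₁ 1 (hci i)
  -- the derivative of `e[χ]`
  have hD : ∀ a, fderiv ℝ (farSmoothingField r₀ r₁ χ) x a =
      ∑ i, fderiv ℝ (newtonFarSmoothing r₀ r₁ fun y => ⟪𝐛 i, χ y⟫) x a • 𝐛 i := by
    intro a
    have hd : ∀ i ∈ Finset.univ, DifferentiableAt ℝ
        (fun x => newtonFarSmoothing r₀ r₁ (fun y => ⟪𝐛 i, χ y⟫) x • 𝐛 i) x := fun i _ =>
      (((hΛi i).differentiable one_ne_zero) x).smul_const _
    have e : farSmoothingField r₀ r₁ χ =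
        fun x => ∑ i, newtonFarSmoothing r₀ r₁ (fun y => ⟪𝐛 i, χ y⟫) x • 𝐛 i := rfl
    rw [e, fderiv_fun_sum hd, FunLike.coe_sum, Finset.sum_apply]
    refine Finset.sum_congr rfl fun i _ => ?_
    rw [fderiv_smul_const (((hΛi i).differentiable one_ne_zero) x), ContinuousLinearMap.smulRight_apply]
  rw [divergence_eq_sum_inner_fderiv 𝐛]
  have step : ∀ j, ⟪𝐛 j, fderiv ℝ (farSmoothingField r₀ r₁ χ) x (𝐛 j)⟫ =
      newtonFarSmoothing r₀ r₁ (fun w => fderiv ℝ (fun y => ⟪𝐛 j, χ y⟫) w (𝐛 j)) x := by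
    intro j
    rw [hD, inner_sum]
    simp only [inner_smul_right, (EuclideanSpace.basisFun (Fin 3) ℝ).inner_eq_ite,
      mul_ite, mul_one, mul_zero, Finset.sum_ite_eq, Finset.mem_univ, if_true]
    exact fderiv_newtonFarSmoothing_apply h₀ h₁ (hci j) x _
  simp only [step]
  rw [← newtonFarSmoothing_finset_sum h₀ h₁ Finset.univ (fun j =>
    ((hci j).continuous_fderiv one_ne_zero).clm_apply continuous_const)]
  congr 1
  funext w
  rw [divergence_eq_sum_inner_fderiv 𝐛]
  refine Finset.sum_congr rfl fun j _ => ?_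
  rw [fderiv_inner_const_left_apply (hχ.differentiable one_ne_zero) _ w]

/-- **`⟪v, De[χ](x) v⟫ = Σᵢⱼ ⟪bᵢ, v⟫⟪bⱼ, v⟫ Λ[⟪bᵢ, ∂ⱼχ⟫](x)`**: the convective pairing against the
corrector in coordinates. [folklore] -/
theorem inner_fderiv_farSmoothingField_apply (h₀ : 0 < r₀) (h₁ : r₀ < r₁) {χ : ℝ³ → ℝ³}
    (hχ : ContDiff ℝ 1 χ) (x v : ℝ³) :
    ⟪v, fderiv ℝ (farSmoothingField r₀ r₁ χ) x v⟫ =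
      ∑ i, ∑ j, ⟪𝐛 i, v⟫ * ⟪𝐛 j, v⟫ *
        newtonFarSmoothing r₀ r₁ (fun w => ⟪𝐛 i, fderiv ℝ χ w (𝐛 j)⟫) x := by
  have hci : ∀ i, ContDiff ℝ 1 fun y => ⟪𝐛 i, χ y⟫ := fun i => contDiff_inner_const_left hχ _
  have hΛi : ∀ i, ContDiff ℝ 1 (newtonFarSmoothing r₀ r₁ fun y => ⟪𝐛 i, χ y⟫) := fun i =>
    contDiff_newtonFarSmoothing h₀ h₁ 1 (hci i)
  have hd : ∀ i ∈ Finset.univ, DifferentiableAt ℝ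
      (fun x => newtonFarSmoothing r₀ r₁ (fun y => ⟪𝐛 i, χ y⟫) x • 𝐛 i) x := fun i _ =>
    (((hΛi i).differentiable one_ne_zero) x).smul_const _
  have e : farSmoothingField r₀ r₁ χ =
      fun x => ∑ i, newtonFarSmoothing r₀ r₁ (fun y => ⟪𝐛 i, χ y⟫) x • 𝐛 i := rfl
  rw [e, fderiv_fun_sum hd, FunLike.coe_sum, Finset.sum_apply, inner_sum]
  refine Finset.sum_congr rfl fun i _ => ?_
  rw [fderiv_smul_const (((hΛi i).differentiable one_ne_zero) x), ContinuousLinearMap.smulRight_apply,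
    inner_smul_right, real_inner_comm, fderiv_newtonFarSmoothing_apply h₀ h₁ (hci i) x v]
  -- expand `v = Σⱼ ⟪bⱼ, v⟫ bⱼ` inside the derivative
  have hv : (fun w => fderiv ℝ (fun y => ⟪𝐛 i, χ y⟫) w v) =
      fun w => ∑ j, ⟪𝐛 j, v⟫ * fderiv ℝ (fun y => ⟪𝐛 i, χ y⟫) w (𝐛 j) := by
    funext w
    conv_lhs => rw [← (EuclideanSpace.basisFun (Fin 3) ℝ).sum_repr' v]
    rw [map_sum]
    refine Finset.sum_congr rfl fun j _ => ?_
    rw [map_smul, smul_eq_mul]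
  rw [hv, newtonFarSmoothing_finset_sum h₀ h₁ Finset.univ
    (g := fun j w => ⟪𝐛 j, v⟫ * fderiv ℝ (fun y => ⟪𝐛 i, χ y⟫) w (𝐛 j))
    (fun j => continuous_const.mul
      (((hci i).continuous_fderiv one_ne_zero).clm_apply continuous_const)), Finset.sum_mul]
  refine Finset.sum_congr rfl fun j _ => ?_
  rw [newtonFarSmoothing_const_mul]
  have hfun : (fun w => fderiv ℝ (fun y => ⟪𝐛 i, χ y⟫) w (𝐛 j)) =
      fun w => ⟪𝐛 i, fderiv ℝ χ w (𝐛 j)⟫ := by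
    funext w
    rw [fderiv_inner_const_left_apply (hχ.differentiable one_ne_zero) _ w]
  rw [hfun]
  ring

/-- **`Δ e[χ] = e[Δχ]`** for `χ ∈ C²`. [folklore] -/
theorem laplacian_farSmoothingField (h₀ : 0 < r₀) (h₁ : r₀ < r₁) {χ : ℝ³ → ℝ³}
    (hχ : ContDiff ℝ 2 χ) (x : ℝ³) :
    Δ (farSmoothingField r₀ r₁ χ) x = farSmoothingField r₀ r₁ (Δ χ) x := by
  have hci : ∀ i, ContDiff ℝ 2 fun y => ⟪𝐛 i, χ y⟫ := fun i => contDiff_inner_const_left hχ _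
  have hΛi : ∀ i, ContDiff ℝ 2 (newtonFarSmoothing r₀ r₁ fun y => ⟪𝐛 i, χ y⟫) := fun i =>
    contDiff_newtonFarSmoothing h₀ h₁ 2 (hci i)
  have e : farSmoothingField r₀ r₁ χ =
      fun x => ∑ i, newtonFarSmoothing r₀ r₁ (fun y => ⟪𝐛 i, χ y⟫) x • 𝐛 i := rfl
  rw [e, laplacian_finsetSum_apply Finset.univ
    (f := fun i x => newtonFarSmoothing r₀ r₁ (fun y => ⟪𝐛 i, χ y⟫) x • 𝐛 i)
    (fun i _ => (hΛi i).smul contDiff_const), farSmoothingField_apply]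
  refine Finset.sum_congr rfl fun i _ => ?_
  rw [laplacian_smul_const_right (hΛi i), laplacian_newtonFarSmoothing h₀ h₁ (hci i)]
  congr 2
  funext y
  exact laplacian_inner_const_left hχ _ y

/-- **`∂ₜ e[ψ(t)] = e[∂ₜψ(t)]`** for a space–time test field `ψ`. [folklore] -/
theorem timeDeriv_farSmoothingField (h₀ : 0 < r₀) (h₁ : r₀ < r₁) {ψ : ℝ → ℝ³ → ℝ³}
    (hψ : IsSpaceTimeTestOn (⊤ : Opens (ℝ × ℝ³)) ψ) (t : ℝ) (x : ℝ³) :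
    timeDeriv (fun s y => farSmoothingField r₀ r₁ (ψ s) y) t x =
      farSmoothingField r₀ r₁ (timeDeriv ψ t) x := by
  have hψi : ∀ i, IsSpaceTimeTestOn (⊤ : Opens (ℝ × ℝ³)) fun s y => ⟪𝐛 i, ψ s y⟫ := fun i =>
    hψ.clm_left (innerSL ℝ (𝐛 i))
  have hΛi : ∀ i, IsSpaceTimeTestOn (⊤ : Opens (ℝ × ℝ³))
      fun s y => newtonFarSmoothing r₀ r₁ (fun y => ⟪𝐛 i, ψ s y⟫) y := fun i =>
    (hψi i).newtonFarSmoothing_top h₀ h₁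
  have e : (fun s y => farSmoothingField r₀ r₁ (ψ s) y) = fun s y =>
      ∑ i, newtonFarSmoothing r₀ r₁ (fun y => ⟪𝐛 i, ψ s y⟫) y • 𝐛 i := rfl
  rw [e, IsSpaceTimeTestOn.timeDeriv_finsetSum Finset.univ (fun i _ => (hΛi i).smul_const _),
    farSmoothingField_apply]
  refine Finset.sum_congr rfl fun i _ => ?_
  have h1 := (hΛi i).timeDeriv_clm_left ((ContinuousLinearMap.id ℝ ℝ).smulRight (𝐛 i)) t x
  simp only [ContinuousLinearMap.smulRight_apply, ContinuousLinearMap.id_apply] at h1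
  rw [h1, timeDeriv_newtonFarSmoothing_slice h₀ h₁ (hψi i)]
  congr 2
  funext y
  exact hψ.timeDeriv_clm_left (innerSL ℝ (𝐛 i)) t y

end Corrector

/-! ### The corrected (divergence-free, compactly supported) test field -/

section Corrected

variable {S r : ℝ}

/-- The slice divergence `(t, x) ↦ div ψ(t, ·)(x)` of a space–time test field on `Q` is a
space–time test function on `Q` (twin of `LocalHelmholtz.isSpaceTimeTestOn_divergence`,
`LocalHelmholtzForce.lean`, whose import closure — space–time mollification — is not needed here).
[folklore] -/
theorem IsSpaceTimeTestOn.divergence_isSpaceTimeTestOn {Q : Opens (ℝ × ℝ³)} {ψ : ℝ → ℝ³ → ℝ³}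
    (hψ : IsSpaceTimeTestOn Q ψ) :
    IsSpaceTimeTestOn Q (fun t x => VectorCalculus.divergence (ψ t) x) := by
  have htop : IsSpaceTimeTestOn (⊤ : Opens (ℝ × ℝ³))
      (fun t x => ∑ i, ⟪𝐛 i, fderiv ℝ (ψ t) x (𝐛 i)⟫) :=
    IsSpaceTimeTestOn.finsetSum Finset.univ fun i _ =>
      ((hψ.mono le_top).fderiv_apply_top (𝐛 i)).clm_left (innerSL ℝ (𝐛 i))
  have e : (fun t x => VectorCalculus.divergence (ψ t) x) =
      fun t x => ∑ i, ⟪𝐛 i, fderiv ℝ (ψ t) x (𝐛 i)⟫ := by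
    funext t x; exact divergence_eq_sum_inner_fderiv 𝐛 (ψ t) x
  obtain ⟨-, h0⟩ := hψ.continuous_divergence_field
  refine ⟨e ▸ htop.contDiff, e ▸ htop.hasCompactSupport, ?_⟩
  refine (closure_minimal (fun z hz => ?_) (isClosed_tsupport _)).trans hψ.tsupport_subset
  by_contra hz'
  exact hz (h0 z hz')

/-- The corrector `(t, x) ↦ e[ψ(t)](x)` of a test field on the open slab `(0, S) × ℝ³` is a test
field on the slab (`0 < r₀ < r₁`). [folklore] -/
theorem isSpaceTimeTestOn_farSmoothingField_slab {r₀ r₁ : ℝ} (hS : 0 < S) {ψ : ℝ → ℝ³ → ℝ³}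
    (hψ : IsSpaceTimeTestOn (slab ℝ³ (Ioo 0 S) isOpen_Ioo) ψ) (h₀ : 0 < r₀) (h₁ : r₀ < r₁) :
    IsSpaceTimeTestOn (slab ℝ³ (Ioo 0 S) isOpen_Ioo) (fun t x => farSmoothingField r₀ r₁ (ψ t) x) :=
  IsSpaceTimeTestOn.finsetSum Finset.univ fun i _ =>
    (((hψ.clm_left (innerSL ℝ (𝐛 i))).newtonFarSmoothing_slab hS h₀ h₁).smul_const (𝐛 i))

/-- **The corrected test field** `w_r[ψ] = ψ - ∇N_{r/2,r}[div ψ] - e_{r/2,r}[ψ]` at scale `r`: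
the truncated Newtonian potential removes the divergence of `ψ` up to the smoothing remainder
`Λ[div ψ]`, which the corrector `e` removes exactly; all three pieces have compact support.
[folklore] -/
def correctedTestField (r : ℝ) (ψ : ℝ → ℝ³ → ℝ³) (t : ℝ) (x : ℝ³) : ℝ³ :=
  ψ t x - gradient (newtonNearPotential (r / 2) r fun y => VectorCalculus.divergence (ψ t) y) x -
    farSmoothingField (r / 2) r (ψ t) x

/-- `w_r[ψ]` is a space–time test field on the slab when `ψ` is (`r > 0`). [folklore] -/
theorem isSpaceTimeTestOn_correctedTestField (hS : 0 < S) {ψ : ℝ → ℝ³ → ℝ³}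
    (hψ : IsSpaceTimeTestOn (slab ℝ³ (Ioo 0 S) isOpen_Ioo) ψ) (hr : 0 < r) :
    IsSpaceTimeTestOn (slab ℝ³ (Ioo 0 S) isOpen_Ioo) (correctedTestField r ψ) :=
  (hψ.sub ((hψ.divergence_isSpaceTimeTestOn.newtonNearPotential_slab hS (half_pos hr).le
    (half_lt_self hr)).gradient_isSpaceTimeTestOn)).sub
    (isSpaceTimeTestOn_farSmoothingField_slab hS hψ (half_pos hr) (half_lt_self hr))

/-- **`w_r[ψ]` has divergence-free slices**: `div ψ - ΔN[div ψ] - div e[ψ] =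
div ψ - (div ψ - Λ[div ψ]) - Λ[div ψ] = 0`. [folklore] -/
theorem isDivFree_correctedTestField {Q : Opens (ℝ × ℝ³)} {ψ : ℝ → ℝ³ → ℝ³}
    (hψ : IsSpaceTimeTestOn Q ψ) (hr : 0 < r) (t : ℝ) :
    VectorCalculus.IsDivFree (correctedTestField r ψ t) := by
  intro x
  have h₀ : 0 < r / 2 := half_pos hr
  have h₁ : r / 2 < r := half_lt_self hr
  set g : ℝ³ → ℝ := fun y => VectorCalculus.divergence (ψ t) y with hg
  have hgs : ContDiff ℝ ∞ g := hψ.divergence_isSpaceTimeTestOn.contDiff_slice t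
  have hN : ContDiff ℝ ∞ (newtonNearPotential (r / 2) r g) := contDiff_newtonNearPotential_top h₀.le h₁ hgs
  have hψt : ContDiff ℝ ∞ (ψ t) := hψ.contDiff_slice t
  have hgrad : Differentiable ℝ (gradient (newtonNearPotential (r / 2) r g)) :=
    ((InnerProductSpace.toDual ℝ ℝ³).symm.differentiable).comp
      ((hN.fderiv_right (m := 1) (by norm_cast)).differentiable one_ne_zero)
  have he : Differentiable ℝ (farSmoothingField (r / 2) r (ψ t)) := by
    refine Differentiable.fun_sum fun i _ => Differentiable.smul_const ?_ _
    exact (contDiff_newtonFarSmoothing h₀ h₁ 1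
      (contDiff_inner_const_left (hψt.of_le (by norm_cast)) _)).differentiable one_ne_zero
  change VectorCalculus.divergence (fun y => ψ t y - gradient (newtonNearPotential (r / 2) r g) y -
    farSmoothingField (r / 2) r (ψ t) y) x = 0
  rw [divergence_sub_apply (v := fun y => ψ t y - gradient (newtonNearPotential (r / 2) r g) y)
      (w := farSmoothingField (r / 2) r (ψ t))
      (((hψt.differentiable (by simp)) x).sub (hgrad x)) (he x),
    divergence_sub_apply (v := ψ t) (w := gradient (newtonNearPotential (r / 2) r g))
      ((hψt.differentiable (by simp)) x) (hgrad x),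
    divergence_gradient (hN.of_le (by norm_cast)) x,
    laplacian_newtonNearPotential h₀ h₁ (hgs.of_le (by norm_cast)) x,
    divergence_farSmoothingField h₀ h₁ (hψt.of_le (by norm_cast)) x]
  ring

end Corrected

/-! ### Integrability on the open slab from the global classes `L³`, `L^{3/2}` -/

section Integrability

variable {S : ℝ}

/-- A function in `L^q` of the slab `(0, S) × ℝ³`, `q ≥ 1`, is locally integrable on the open
slab. [folklore] -/
theorem locallyIntegrableOn_slab_of_memLp {F : Type*} [NormedAddCommGroup F] {f : ℝ × ℝ³ → F}
    {q : ℝ≥0∞} (hf : MemLp f q (volume.restrict (Ioo 0 S ×ˢ (univ : Set ℝ³)))) (hq : 1 ≤ q) :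
    LocallyIntegrableOn f ((slab ℝ³ (Ioo 0 S) isOpen_Ioo : Opens (ℝ × ℝ³)) : Set (ℝ × ℝ³)) volume :=
  locallyIntegrableOn_of_locallyIntegrable_restrict (hf.locallyIntegrable hq)

/-- `|f|² ∈ L^{3/2}` for `f ∈ L³`. [folklore] -/
theorem memLp_norm_sq_of_memLp_three {α : Type*} [MeasurableSpace α] {μ : Measure α}
    {F : Type*} [NormedAddCommGroup F] {f : α → F} (hf : MemLp f 3 μ) :
    MemLp (fun z => ‖f z‖ ^ 2) (3 / 2) μ := by
  have h := hf.norm_rpow_div (2 : ℝ≥0∞)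
  simpa [Real.rpow_two] using h

variable {Q : Opens (ℝ × ℝ³)} {u : ℝ → ℝ³ → ℝ³}

/-- **Integrability of the convective pairing** `⟪u, D(z) u⟫` on `Q` for `|u|² ∈ L¹_loc(Q)` and a
continuous operator field `D` supported in a compact subset of `Q` (private twin of the identical
lemma of `ForwardDSSExistenceLocalProofs.lean`, whose import closure is unrelated and heavy).
[folklore] -/
private theorem integrable_convectivePairing_of_locallyIntegrableOn_sq
    (hu : LocallyIntegrableOn (uncurry u) (Q : Set (ℝ × ℝ³)) volume)
    (hu2 : LocallyIntegrableOn (fun z => ‖uncurry u z‖ ^ 2) (Q : Set (ℝ × ℝ³)) volume)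
    {D : ℝ × ℝ³ → ℝ³ →L[ℝ] ℝ³} (hD : Continuous D) {K : Set (ℝ × ℝ³)} (hK : IsCompact K)
    (hKQ : K ⊆ (Q : Set (ℝ × ℝ³))) (hDK : ∀ z ∉ K, D z = 0) :
    Integrable (fun z : ℝ × ℝ³ => ⟪u z.1 z.2, D z (u z.1 z.2)⟫) (volume : Measure (ℝ × ℝ³)) := by
  have huK : IntegrableOn (uncurry u) K volume := hu.integrableOn_compact_subset hKQ hK
  have hu2K : IntegrableOn (fun z => ‖uncurry u z‖ ^ 2) K volume :=
    hu2.integrableOn_compact_subset hKQ hK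
  have hDc : HasCompactSupport D := HasCompactSupport.intro hK hDK
  obtain ⟨C, hC⟩ := hD.bounded_above_of_compact_support hDc
  have hsupp : support (fun z : ℝ × ℝ³ => ⟪u z.1 z.2, D z (u z.1 z.2)⟫) ⊆ K := by
    intro z hz
    by_contra hzK
    exact hz (by simp [hDK z hzK])
  refine (integrableOn_iff_integrable_of_support_subset hsupp).1 ?_
  have hm : AEStronglyMeasurable (fun z : ℝ × ℝ³ => D z (u z.1 z.2)) (volume.restrict K) :=
    isBoundedBilinearMap_apply.continuous.comp_aestronglyMeasurable
      (hD.aestronglyMeasurable.prodMk huK.aestronglyMeasurable)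
  refine Integrable.mono' (hu2K.const_mul C) (huK.aestronglyMeasurable.inner hm) ?_
  filter_upwards with z
  calc ‖⟪u z.1 z.2, D z (u z.1 z.2)⟫‖ ≤ ‖u z.1 z.2‖ * ‖D z (u z.1 z.2)‖ := norm_inner_le_norm _ _
    _ ≤ ‖u z.1 z.2‖ * (C * ‖u z.1 z.2‖) := by
        gcongr
        exact (ContinuousLinearMap.le_opNorm _ _).trans
          (mul_le_mul_of_nonneg_right (hC z) (norm_nonneg _))
    _ = C * ‖uncurry u z‖ ^ 2 := by change _ = C * ‖u z.1 z.2‖ ^ 2; ring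

/-- **Integrability of `⟪a, u⟫⟪c, u⟫ G`** on `Q` for `|u|² ∈ L¹_loc(Q)`, `|a|, |c| ≤ 1`, and a
continuous `G` supported in a compact subset of `Q`. [folklore] -/
theorem integrable_inner_mul_inner_mul_of_locallyIntegrableOn_sq
    (hu : LocallyIntegrableOn (uncurry u) (Q : Set (ℝ × ℝ³)) volume)
    (hu2 : LocallyIntegrableOn (fun z => ‖uncurry u z‖ ^ 2) (Q : Set (ℝ × ℝ³)) volume)
    {G : ℝ × ℝ³ → ℝ} (hG : Continuous G) {K : Set (ℝ × ℝ³)} (hK : IsCompact K)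
    (hKQ : K ⊆ (Q : Set (ℝ × ℝ³))) (hGK : ∀ z ∉ K, G z = 0) {a c : ℝ³} (ha : ‖a‖ ≤ 1) (hc : ‖c‖ ≤ 1) :
    Integrable (fun z : ℝ × ℝ³ => ⟪a, u z.1 z.2⟫ * ⟪c, u z.1 z.2⟫ * G z) (volume : Measure (ℝ × ℝ³)) := by
  have huK : IntegrableOn (uncurry u) K volume := hu.integrableOn_compact_subset hKQ hK
  have hu2K : IntegrableOn (fun z => ‖uncurry u z‖ ^ 2) K volume :=
    hu2.integrableOn_compact_subset hKQ hK
  have hGc : HasCompactSupport G := HasCompactSupport.intro hK hGK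
  obtain ⟨C, hC⟩ := hG.bounded_above_of_compact_support hGc
  have hsupp : support (fun z : ℝ × ℝ³ => ⟪a, u z.1 z.2⟫ * ⟪c, u z.1 z.2⟫ * G z) ⊆ K := by
    intro z hz
    by_contra hzK
    exact hz (by simp [hGK z hzK])
  refine (integrableOn_iff_integrable_of_support_subset hsupp).1 ?_
  have hm : AEStronglyMeasurable (fun z : ℝ × ℝ³ => ⟪a, u z.1 z.2⟫ * ⟪c, u z.1 z.2⟫ * G z)
      (volume.restrict K) :=
    ((aestronglyMeasurable_const.inner huK.aestronglyMeasurable).mul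
      (aestronglyMeasurable_const.inner huK.aestronglyMeasurable)).mul hG.aestronglyMeasurable
  refine Integrable.mono' (hu2K.mul_const C) hm ?_
  filter_upwards with z
  rw [norm_mul, norm_mul]
  have h1 : ‖⟪a, u z.1 z.2⟫‖ ≤ ‖u z.1 z.2‖ :=
    (norm_inner_le_norm _ _).trans (mul_le_of_le_one_left (norm_nonneg _) ha)
  have h2 : ‖⟪c, u z.1 z.2⟫‖ ≤ ‖u z.1 z.2‖ :=
    (norm_inner_le_norm _ _).trans (mul_le_of_le_one_left (norm_nonneg _) hc)
  calc ‖⟪a, u z.1 z.2⟫‖ * ‖⟪c, u z.1 z.2⟫‖ * ‖G z‖ ≤ ‖u z.1 z.2‖ * ‖u z.1 z.2‖ * C :=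
        mul_le_mul (mul_le_mul h1 h2 (norm_nonneg _) (norm_nonneg _)) (hC z) (norm_nonneg _)
          (by positivity)
    _ = ‖uncurry u z‖ ^ 2 * C := by change _ = ‖u z.1 z.2‖ ^ 2 * C; ring

end Integrability

/-! ### Hölder against the volume of a box, and the vanishing of the remainder terms -/

section Vanishing

/-- **Hölder against a set**: `∫_B f ≤ ‖f‖_{L^q} μ(B)^{1/q'}` for conjugate exponents. [folklore] -/
theorem setLIntegral_le_lintegral_rpow_mul_measure_rpow {α : Type*} [MeasurableSpace α]
    {μ : Measure α} {f : α → ℝ≥0∞} (hf : AEMeasurable f μ) {B : Set α} (hB : MeasurableSet B)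
    {q q' : ℝ} (hqq' : q.HolderConjugate q') :
    ∫⁻ z in B, f z ∂μ ≤ (∫⁻ z, f z ^ q ∂μ) ^ (1 / q) * μ B ^ (1 / q') := by
  have hq' : 0 < q' := hqq'.symm.pos
  set g : α → ℝ≥0∞ := B.indicator fun _ => 1 with hg
  have hgm : AEMeasurable g μ := (aemeasurable_indicator_iff hB).2 aemeasurable_const
  have e1 : ∫⁻ z in B, f z ∂μ = ∫⁻ z, (f * g) z ∂μ := by
    rw [← lintegral_indicator hB]
    refine lintegral_congr fun z => ?_
    by_cases hz : z ∈ B <;> simp [hg, hz]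
  have e2 : ∫⁻ z, g z ^ q' ∂μ = μ B := by
    rw [← lintegral_indicator_one hB]
    refine lintegral_congr fun z => ?_
    by_cases hz : z ∈ B
    · simp [hg, hz]
    · simp [hg, hz, ENNReal.zero_rpow_of_pos hq']
  rw [e1]
  calc ∫⁻ z, (f * g) z ∂μ
      ≤ (∫⁻ z, f z ^ q ∂μ) ^ (1 / q) * (∫⁻ z, g z ^ q' ∂μ) ^ (1 / q') :=
        ENNReal.lintegral_mul_le_Lp_mul_Lq μ hqq' hf hgm
    _ = (∫⁻ z, f z ^ q ∂μ) ^ (1 / q) * μ B ^ (1 / q') := by rw [e2]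

/-- The volume of the box `[a, b] × B̄(0, ρ)` in `ℝ × ℝ³`. [folklore] -/
theorem volume_Icc_prod_closedBall (a b : ℝ) {ρ : ℝ} (hρ : 0 ≤ ρ) :
    volume (Icc a b ×ˢ closedBall (0 : ℝ³) ρ) =
      ENNReal.ofReal (b - a) * (ENNReal.ofReal (ρ ^ 3) * volume (ball (0 : ℝ³) 1)) := by
  rw [show (volume : Measure (ℝ × ℝ³)) = (volume : Measure ℝ).prod (volume : Measure ℝ³) from rfl,
    Measure.prod_prod, Real.volume_Icc, Measure.addHaar_closedBall _ _ hρ, finrank_euclideanSpace_fin]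

variable {S : ℝ}

/-- **Vanishing of the remainder terms.** Let `F ∈ L^q((0,S) × ℝ³)`, `1 < q < ∞` (conjugate
exponent `q'`), and let `Φ_r`, `r ≥ r₁`, be measurable? — no measurability is needed — functions
on `ℝ × ℝ³` with `|Φ_r| ≤ |F| · C/r³` on the box `[a, b] × B̄(0, R₀ + r)` and `Φ_r = 0` off it.
Then `∫∫_{(0,S) × ℝ³} Φ_r → 0` as `r → ∞`: by Hölder,
`|∫∫ Φ_r| ≤ (C/r³) ‖F‖_q ((b-a) |B̄(0,R₀+r)|)^{1/q'} = O(r^{3/q' - 3})` and `3/q' < 3`. [folklore] -/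
theorem tendsto_setIntegral_slab_of_bound {G : Type*} [NormedAddCommGroup G] {F : ℝ × ℝ³ → G}
    {q q' : ℝ} (hqq' : q.HolderConjugate q')
    (hFm : AEMeasurable (fun z => ‖F z‖ₑ) (volume.restrict (Ioo 0 S ×ˢ (univ : Set ℝ³))))
    (hFq : ∫⁻ z in Ioo 0 S ×ˢ (univ : Set ℝ³), ‖F z‖ₑ ^ q < ⊤)
    {Φ : ℝ → ℝ × ℝ³ → ℝ} {C R₀ a b r₁ : ℝ} (hR₀ : 0 ≤ R₀)
    (hbound : ∀ r, r₁ ≤ r → ∀ z ∈ Icc a b ×ˢ closedBall (0 : ℝ³) (R₀ + r), ‖Φ r z‖ ≤ ‖F z‖ * (C / r ^ 3))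
    (hzero : ∀ r, r₁ ≤ r → ∀ z ∉ Icc a b ×ˢ closedBall (0 : ℝ³) (R₀ + r), Φ r z = 0) :
    Tendsto (fun r => ∫ z in Ioo 0 S ×ˢ (univ : Set ℝ³), Φ r z) atTop (𝓝 0) := by
  set μ' : Measure (ℝ × ℝ³) := volume.restrict (Ioo 0 S ×ˢ (univ : Set ℝ³)) with hμ'
  set I : ℝ≥0∞ := ∫⁻ z, ‖F z‖ₑ ^ q ∂μ' with hI
  set V₁ : ℝ≥0∞ := volume (ball (0 : ℝ³) 1) with hV₁
  have hV₁top : V₁ < ⊤ := measure_ball_lt_top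
  have hq : 0 < q := hqq'.pos
  have hq' : 0 < q' := hqq'.symm.pos
  have hq'1 : 1 < q' := hqq'.symm.lt
  have hC : ∀ r, r₁ ≤ r → max R₀ 1 ≤ r → 0 ≤ C ∨ ∀ z, Φ r z = 0 := by
    intro r hr hr'
    by_cases h : 0 ≤ C
    · exact Or.inl h
    · refine Or.inr fun z => ?_
      by_cases hz : z ∈ Icc a b ×ˢ closedBall (0 : ℝ³) (R₀ + r)
      · have h1 := hbound r hr z hz
        have hr0 : 0 ≤ r := zero_le_one.trans ((le_max_right R₀ 1).trans hr')
        have h2 : ‖F z‖ * (C / r ^ 3) ≤ 0 := by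
          have : C / r ^ 3 ≤ 0 := div_nonpos_of_nonpos_of_nonneg (le_of_lt (not_le.1 h))
            (pow_nonneg hr0 3)
          exact mul_nonpos_of_nonneg_of_nonpos (norm_nonneg _) this
        exact norm_le_zero_iff.1 (h1.trans h2)
      · exact hzero r hr z hz
  -- the real majorant
  set K : ℝ := |C| * (I ^ (1 / q)).toReal *
    ((ENNReal.ofReal (b - a) * (ENNReal.ofReal 8 * V₁)) ^ (1 / q')).toReal with hK
  have hK0 : 0 ≤ K := by positivity
  -- the bound `‖∫ Φ_r‖ ≤ K * r^{3/q' - 3}` for `r ≥ max r₁ (max R₀ 1)`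
  have key : ∀ r, max r₁ (max R₀ 1) ≤ r →
      ‖∫ z in Ioo 0 S ×ˢ (univ : Set ℝ³), Φ r z‖ ≤ K * r ^ (3 / q' - 3) := by
    intro r hr
    have hr₁ : r₁ ≤ r := (le_max_left _ _).trans hr
    have hrR : max R₀ 1 ≤ r := (le_max_right _ _).trans hr
    have hr1 : 1 ≤ r := (le_max_right _ _).trans hrR
    have hr0 : 0 < r := one_pos.trans_le hr1
    have hRr : R₀ ≤ r := (le_max_left _ _).trans hrR
    set B : Set (ℝ × ℝ³) := Icc a b ×ˢ closedBall (0 : ℝ³) (R₀ + r) with hB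
    have hBm : MeasurableSet B := measurableSet_Icc.prod measurableSet_closedBall
    rcases hC r hr₁ hrR with hC0 | hΦ0
    · -- Step 1: domination by the indicator of the box
      have hpt : ∀ z, ‖Φ r z‖ₑ ≤ B.indicator (fun z => ENNReal.ofReal (C / r ^ 3) * ‖F z‖ₑ) z := by
        intro z
        by_cases hz : z ∈ B
        · rw [indicator_of_mem hz, ← ofReal_norm, ← ofReal_norm, ← ENNReal.ofReal_mul (by positivity),
            mul_comm]
          exact ENNReal.ofReal_le_ofReal (hbound r hr₁ z hz)
        · rw [indicator_of_notMem hz, hzero r hr₁ z hz, enorm_zero]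
      have h1 : ∫⁻ z, ‖Φ r z‖ₑ ∂μ' ≤ ENNReal.ofReal (C / r ^ 3) * ∫⁻ z in B, ‖F z‖ₑ ∂μ' := by
        calc ∫⁻ z, ‖Φ r z‖ₑ ∂μ' ≤ ∫⁻ z, B.indicator (fun z => ENNReal.ofReal (C / r ^ 3) * ‖F z‖ₑ) z ∂μ' :=
              lintegral_mono hpt
          _ = ENNReal.ofReal (C / r ^ 3) * ∫⁻ z in B, ‖F z‖ₑ ∂μ' := by
              rw [lintegral_indicator hBm, lintegral_const_mul'' _ hFm.restrict]
      -- Step 2: Hölder against the box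
      have h2 : ∫⁻ z in B, ‖F z‖ₑ ∂μ' ≤ I ^ (1 / q) * μ' B ^ (1 / q') :=
        setLIntegral_le_lintegral_rpow_mul_measure_rpow hFm hBm hqq'
      -- Step 3: the volume of the box
      have h3 : μ' B ≤ ENNReal.ofReal (b - a) * (ENNReal.ofReal 8 * V₁) * ENNReal.ofReal (r ^ 3) := by
        calc μ' B ≤ volume B := Measure.restrict_apply_le _ _
          _ = ENNReal.ofReal (b - a) * (ENNReal.ofReal ((R₀ + r) ^ 3) * V₁) :=
              volume_Icc_prod_closedBall a b (by linarith)
          _ ≤ ENNReal.ofReal (b - a) * (ENNReal.ofReal ((2 * r) ^ 3) * V₁) := by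
              gcongr; linarith
          _ = ENNReal.ofReal (b - a) * (ENNReal.ofReal 8 * V₁) * ENNReal.ofReal (r ^ 3) := by
              rw [show (2 * r) ^ 3 = 8 * r ^ 3 by ring, ENNReal.ofReal_mul (by norm_num)]; ring
      have h3' : μ' B ^ (1 / q') ≤
          (ENNReal.ofReal (b - a) * (ENNReal.ofReal 8 * V₁)) ^ (1 / q') * ENNReal.ofReal (r ^ (3 / q')) := by
        calc μ' B ^ (1 / q') ≤ (ENNReal.ofReal (b - a) * (ENNReal.ofReal 8 * V₁) * ENNReal.ofReal (r ^ 3)) ^ (1 / q') :=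
              ENNReal.rpow_le_rpow h3 (by positivity)
          _ = (ENNReal.ofReal (b - a) * (ENNReal.ofReal 8 * V₁)) ^ (1 / q') *
                ENNReal.ofReal (r ^ 3) ^ (1 / q') := ENNReal.mul_rpow_of_nonneg _ _ (by positivity)
          _ = _ := by
              have e3 : (r ^ 3) ^ (1 / q') = r ^ (3 / q') := by
                rw [show r ^ 3 = r ^ (3 : ℝ) by exact_mod_cast (Real.rpow_natCast r 3).symm,
                  ← Real.rpow_mul hr0.le]
                congr 1; ring
              rw [ENNReal.ofReal_rpow_of_pos (by positivity), e3]
      -- Step 4: assemble in `ℝ`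
      have hItop : I ^ (1 / q) ≠ ⊤ := ENNReal.rpow_ne_top_of_nonneg (by positivity) hFq.ne
      have hWtop : (ENNReal.ofReal (b - a) * (ENNReal.ofReal 8 * V₁)) ^ (1 / q') ≠ ⊤ :=
        ENNReal.rpow_ne_top_of_nonneg (by positivity) (ENNReal.mul_ne_top ENNReal.ofReal_ne_top
          (ENNReal.mul_ne_top ENNReal.ofReal_ne_top hV₁top.ne))
      have h4 : ∫⁻ z, ‖Φ r z‖ₑ ∂μ' ≤ ENNReal.ofReal (C / r ^ 3) * (I ^ (1 / q) *
          ((ENNReal.ofReal (b - a) * (ENNReal.ofReal 8 * V₁)) ^ (1 / q') * ENNReal.ofReal (r ^ (3 / q')))) :=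
        h1.trans (mul_le_mul_right (h2.trans (mul_le_mul_right h3' _)) _)
      have h5 : (ENNReal.ofReal (C / r ^ 3) * (I ^ (1 / q) *
          ((ENNReal.ofReal (b - a) * (ENNReal.ofReal 8 * V₁)) ^ (1 / q') * ENNReal.ofReal (r ^ (3 / q'))))).toReal =
          K * r ^ (3 / q' - 3) := by
        have e3 : r ^ (3 / q' - 3) = r ^ (3 / q') / r ^ 3 := by
          rw [Real.rpow_sub hr0]; congr 1; exact_mod_cast Real.rpow_natCast r 3
        rw [ENNReal.toReal_mul, ENNReal.toReal_mul, ENNReal.toReal_mul, ENNReal.toReal_ofReal (by positivity),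
          ENNReal.toReal_ofReal (by positivity), hK, abs_of_nonneg hC0, e3]
        ring
      calc ‖∫ z in Ioo 0 S ×ˢ (univ : Set ℝ³), Φ r z‖
          ≤ (∫⁻ z, ENNReal.ofReal ‖Φ r z‖ ∂μ').toReal := norm_integral_le_lintegral_norm _
        _ = (∫⁻ z, ‖Φ r z‖ₑ ∂μ').toReal := by simp only [ofReal_norm]
        _ ≤ K * r ^ (3 / q' - 3) := by
            rw [← h5]
            exact ENNReal.toReal_mono (ENNReal.mul_ne_top ENNReal.ofReal_ne_top
              (ENNReal.mul_ne_top hItop (ENNReal.mul_ne_top hWtop ENNReal.ofReal_ne_top))) h4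
    · -- degenerate case `C < 0`: `Φ_r = 0`
      have : (fun z => Φ r z) = fun _ => 0 := funext hΦ0
      simp only [this, integral_zero, norm_zero]
      positivity
  -- conclusion: `K r^{3/q' - 3} → 0`
  have hexp : 3 / q' - 3 < 0 := by
    have : 3 / q' < 3 := by rw [div_lt_iff₀ hq']; nlinarith
    linarith
  have hlim : Tendsto (fun r : ℝ => K * r ^ (3 / q' - 3)) atTop (𝓝 0) := by
    have h := (tendsto_rpow_neg_atTop (y := -(3 / q' - 3)) (by linarith)).const_mul K
    rw [mul_zero] at h
    refine h.congr' ?_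
    filter_upwards [eventually_gt_atTop 0] with r hr
    rw [neg_neg]
  refine squeeze_zero_norm' ?_ hlim
  filter_upwards [eventually_ge_atTop (max r₁ (max R₀ 1))] with r hr
  exact key r hr

end Vanishing

/-! ### The very weak integrand and its pieces -/

section Integrand

variable {S ν : ℝ} {u : ℝ → ℝ³ → ℝ³} {p : ℝ → ℝ³ → ℝ}

/-- **The very weak (pressure-free) integrand** `⟪u, ∂ₜχ⟫ + ⟪u, (u·∇)χ⟫ + ν⟪u, Δχ⟫` of the
momentum equation tested with a vector field `χ` (Lemarié-Rieusset 2016, Def. 6.2, (6.2)).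
[cite: LemarieRieusset2016, Def. 6.2 (file p. 126)] -/
def veryWeakIntegrand (ν : ℝ) (u : ℝ → ℝ³ → ℝ³) (χ : ℝ → ℝ³ → ℝ³) (z : ℝ × ℝ³) : ℝ :=
  ⟪u z.1 z.2, timeDeriv χ z.1 z.2⟫ + ⟪u z.1 z.2, convect (u z.1) (χ z.1) z.2⟫ +
    ν * ⟪u z.1 z.2, Δ (χ z.1) z.2⟫

/-- Unfolding `veryWeakIntegrand`. [folklore] -/
theorem veryWeakIntegrand_apply (ν : ℝ) (u : ℝ → ℝ³ → ℝ³) (χ : ℝ → ℝ³ → ℝ³) (z : ℝ × ℝ³) :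
    veryWeakIntegrand ν u χ z = ⟪u z.1 z.2, timeDeriv χ z.1 z.2⟫ +
      ⟪u z.1 z.2, convect (u z.1) (χ z.1) z.2⟫ + ν * ⟪u z.1 z.2, Δ (χ z.1) z.2⟫ :=
  rfl

/-- Linearity of the very weak integrand in the test field (differences of test fields).
[folklore] -/
theorem veryWeakIntegrand_sub {Q : Opens (ℝ × ℝ³)} {χ₁ χ₂ : ℝ → ℝ³ → ℝ³}
    (h₁ : IsSpaceTimeTestOn Q χ₁) (h₂ : IsSpaceTimeTestOn Q χ₂) (z : ℝ × ℝ³) :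
    veryWeakIntegrand ν u (fun t x => χ₁ t x - χ₂ t x) z =
      veryWeakIntegrand ν u χ₁ z - veryWeakIntegrand ν u χ₂ z := by
  simp only [veryWeakIntegrand_apply, convect]
  have hd₁ : DifferentiableAt ℝ (χ₁ z.1) z.2 := ((h₁.contDiff_slice z.1).differentiable (by simp)) z.2
  have hd₂ : DifferentiableAt ℝ (χ₂ z.1) z.2 := ((h₂.contDiff_slice z.1).differentiable (by simp)) z.2
  have hc₁ : ContDiffAt ℝ 2 (χ₁ z.1) z.2 := ((h₁.contDiff_slice z.1).of_le (by norm_cast)).contDiffAt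
  have hc₂ : ContDiffAt ℝ 2 (χ₂ z.1) z.2 := ((h₂.contDiff_slice z.1).of_le (by norm_cast)).contDiffAt
  rw [h₁.timeDeriv_sub h₂, show (fun x => χ₁ z.1 x - χ₂ z.1 x) = χ₁ z.1 - χ₂ z.1 from rfl,
    fderiv_sub hd₁ hd₂, hc₁.laplacian_sub hc₂]
  simp only [inner_sub_right, FunLike.coe_sub, Pi.sub_apply]
  ring

variable {Q : Opens (ℝ × ℝ³)}

/-- **Integrability of the three very weak terms** on `Q` for `u, |u|² ∈ L¹_loc(Q)` and a test field
`χ` on `Q`. [folklore] -/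
theorem integrable_veryWeak_terms (hu1 : LocallyIntegrableOn (uncurry u) (Q : Set (ℝ × ℝ³)) volume)
    (hu2 : LocallyIntegrableOn (fun z => ‖uncurry u z‖ ^ 2) (Q : Set (ℝ × ℝ³)) volume)
    {χ : ℝ → ℝ³ → ℝ³} (hχ : IsSpaceTimeTestOn Q χ) (ν : ℝ) :
    Integrable (fun z : ℝ × ℝ³ => ⟪u z.1 z.2, timeDeriv χ z.1 z.2⟫) (volume : Measure (ℝ × ℝ³)) ∧
      Integrable (fun z : ℝ × ℝ³ => ⟪u z.1 z.2, convect (u z.1) (χ z.1) z.2⟫)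
        (volume : Measure (ℝ × ℝ³)) ∧
      Integrable (fun z : ℝ × ℝ³ => ν * ⟪u z.1 z.2, Δ (χ z.1) z.2⟫) (volume : Measure (ℝ × ℝ³)) := by
  have hK : IsCompact (tsupport (uncurry χ)) := hχ.hasCompactSupport
  have hKQ : tsupport (uncurry χ) ⊆ (Q : Set (ℝ × ℝ³)) := hχ.tsupport_subset
  refine ⟨?_, ?_, ?_⟩
  · have h := hχ.timeDeriv_isSpaceTimeTestOn
    exact integrable_inner_of_locallyIntegrableOn hu1 (w := uncurry (timeDeriv χ))
      h.contDiff.continuous hK hKQ fun z hz =>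
        IsSpaceTimeTestOn.timeDeriv_eq_zero_of_notMem (ψ := χ) (t := z.1) (x := z.2) hz
  · have hD : Continuous fun z : ℝ × ℝ³ => fderiv ℝ (χ z.1) z.2 :=
      (hχ.mono le_top).fderiv_top.contDiff.continuous
    exact integrable_convectivePairing_of_locallyIntegrableOn_sq hu1 hu2 hD hK hKQ fun z hz =>
      IsSpaceTimeTestOn.fderiv_slice_eq_zero_of_notMem hz
  · have h := hχ.laplacian_isSpaceTimeTestOn
    have hI := integrable_inner_of_locallyIntegrableOn hu1 (w := uncurry fun t => Δ (χ t))
      h.contDiff.continuous hK hKQ fun z hz => laplacian_slice_eq_zero_of_notMem_tsupport hz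
    exact hI.const_mul ν

/-- The very weak integrand of a test field is integrable on `Q`. [folklore] -/
theorem integrable_veryWeakIntegrand (hu1 : LocallyIntegrableOn (uncurry u) (Q : Set (ℝ × ℝ³)) volume)
    (hu2 : LocallyIntegrableOn (fun z => ‖uncurry u z‖ ^ 2) (Q : Set (ℝ × ℝ³)) volume)
    {χ : ℝ → ℝ³ → ℝ³} (hχ : IsSpaceTimeTestOn Q χ) (ν : ℝ) :
    Integrable (veryWeakIntegrand ν u χ) (volume : Measure (ℝ × ℝ³)) := by
  obtain ⟨h1, h2, h3⟩ := integrable_veryWeak_terms hu1 hu2 hχ ν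
  exact (h1.add h2).add h3

/-- **The very weak integrand against a gradient test field** `∇θ`, `θ ∈ C_c^∞(Q)`: if `u` is
weakly divergence free on `Q` and `p` solves the weak pressure equation
`∫∫_Q p Δθ = -∫∫_Q D²θ(u, u)`, then `∫∫_Q W(∇θ) = -∫∫_Q p Δθ` (`∂ₜ∇θ = ∇∂ₜθ` and `Δ∇θ = ∇Δθ`
pair to zero with `u`; `⟪u, (u·∇)∇θ⟫ = D²θ(u, u)`). [folklore] -/
theorem setIntegral_veryWeakIntegrand_gradient
    (hu1 : LocallyIntegrableOn (uncurry u) (Q : Set (ℝ × ℝ³)) volume)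
    (hu2 : LocallyIntegrableOn (fun z => ‖uncurry u z‖ ^ 2) (Q : Set (ℝ × ℝ³)) volume)
    (hdiv : ∀ θ : ℝ → ℝ³ → ℝ, IsSpaceTimeTestOn Q θ →
      ∫ z in (Q : Set (ℝ × ℝ³)), ⟪u z.1 z.2, gradient (θ z.1) z.2⟫ = 0)
    (hpois : ∀ θ : ℝ → ℝ³ → ℝ, IsSpaceTimeTestOn Q θ →
      ∫ z in (Q : Set (ℝ × ℝ³)), p z.1 z.2 * Δ (θ z.1) z.2 =
        -∫ z in (Q : Set (ℝ × ℝ³)), fderiv ℝ (fderiv ℝ (θ z.1)) z.2 (u z.1 z.2) (u z.1 z.2))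
    {θ : ℝ → ℝ³ → ℝ} (hθ : IsSpaceTimeTestOn Q θ) :
    ∫ z in (Q : Set (ℝ × ℝ³)), veryWeakIntegrand ν u (fun t x => gradient (θ t) x) z =
      -∫ z in (Q : Set (ℝ × ℝ³)), p z.1 z.2 * Δ (θ z.1) z.2 := by
  have hψ := hθ.gradient_isSpaceTimeTestOn
  have h1 := hθ.timeDeriv_isSpaceTimeTestOn
  have h2 := hθ.laplacian_isSpaceTimeTestOn
  have hθ2 : ∀ t, ContDiff ℝ 2 (θ t) := fun t => (hθ.contDiff_slice t).of_le (by norm_cast)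
  have hθ3 : ∀ t, ContDiff ℝ 3 (θ t) := fun t => (hθ.contDiff_slice t).of_le (by norm_cast)
  -- pointwise form of the integrand
  have hpt : ∀ z : ℝ × ℝ³, veryWeakIntegrand ν u (fun t x => gradient (θ t) x) z =
      fderiv ℝ (fderiv ℝ (θ z.1)) z.2 (u z.1 z.2) (u z.1 z.2) +
        (⟪u z.1 z.2, gradient (timeDeriv θ z.1) z.2⟫ +
          ν * ⟪u z.1 z.2, gradient (fun y => Δ (θ z.1) y) z.2⟫) := by
    rintro ⟨t, x⟩
    rw [veryWeakIntegrand_apply]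
    have e1 : timeDeriv (fun s y => gradient (θ s) y) t x = gradient (timeDeriv θ t) x :=
      hθ.timeDeriv_gradient t x
    have e2 : convect (u t) (fun y => gradient (θ t) y) x = fderiv ℝ (gradient (θ t)) x (u t x) :=
      rfl
    have e3 : Δ (fun y => gradient (θ t) y) x = gradient (fun y => Δ (θ t) y) x :=
      laplacian_gradient (hθ3 t) x
    simp only
    rw [e1, e2, inner_fderiv_gradient_apply (hθ2 t), e3]
    ring
  simp_rw [hpt]
  obtain ⟨c1, -, z1⟩ := h1.continuous_gradient_field
  obtain ⟨c2, -, z2⟩ := h2.continuous_gradient_field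
  have I1 : Integrable (fun z : ℝ × ℝ³ => ⟪u z.1 z.2, gradient (timeDeriv θ z.1) z.2⟫)
      (volume : Measure (ℝ × ℝ³)) :=
    integrable_inner_of_locallyIntegrableOn hu1 c1 h1.hasCompactSupport h1.tsupport_subset z1
  have I2 : Integrable (fun z : ℝ × ℝ³ => ⟪u z.1 z.2, gradient (fun y => Δ (θ z.1) y) z.2⟫)
      (volume : Measure (ℝ × ℝ³)) :=
    integrable_inner_of_locallyIntegrableOn hu1 c2 h2.hasCompactSupport h2.tsupport_subset z2
  have I12 : Integrable (fun z : ℝ × ℝ³ => ⟪u z.1 z.2, gradient (timeDeriv θ z.1) z.2⟫ +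
      ν * ⟪u z.1 z.2, gradient (fun y => Δ (θ z.1) y) z.2⟫)
      ((volume : Measure (ℝ × ℝ³)).restrict (Q : Set (ℝ × ℝ³))) :=
    I1.integrableOn.add (I2.integrableOn.const_mul ν)
  have hzero : ∫ z in (Q : Set (ℝ × ℝ³)), (⟪u z.1 z.2, gradient (timeDeriv θ z.1) z.2⟫ +
      ν * ⟪u z.1 z.2, gradient (fun y => Δ (θ z.1) y) z.2⟫) = 0 := by
    rw [integral_add I1.integrableOn (I2.integrableOn.const_mul ν), integral_const_mul, hdiv _ h1,
      hdiv _ h2]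
    ring
  -- the Hessian term is integrable (it is the convective term)
  obtain ⟨-, Ic, -⟩ := integrable_veryWeak_terms hu1 hu2 hψ ν
  have Ic' : Integrable (fun z : ℝ × ℝ³ => fderiv ℝ (fderiv ℝ (θ z.1)) z.2 (u z.1 z.2) (u z.1 z.2))
      (volume : Measure (ℝ × ℝ³)) := by
    refine Ic.congr (Eventually.of_forall fun z => ?_)
    exact inner_fderiv_gradient_apply (hθ2 z.1) z.2 (u z.1 z.2)
  rw [integral_add Ic'.integrableOn I12, hzero, add_zero, hpois θ hθ, neg_neg]

end Integrand

/-! ### Support and size of the remainder fields at scale `r` -/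

section RemainderBounds

variable {a b R₀ r : ℝ}

/-- Off the box `[a, b] × B̄(0, R₀ + r)` the slicewise smoothing remainder at scale `r` of a
function vanishing off `[a, b] × B̄(0, R₀)` vanishes. [folklore] -/
theorem newtonFarSmoothing_slice_eq_zero_of_notMem {θ : ℝ → ℝ³ → ℝ}
    (hθ : ∀ t y, (t, y) ∉ Icc a b ×ˢ closedBall (0 : ℝ³) R₀ → θ t y = 0) (hr : 0 < r)
    {z : ℝ × ℝ³} (hz : z ∉ Icc a b ×ˢ closedBall (0 : ℝ³) (R₀ + r)) :
    newtonFarSmoothing (r / 2) r (θ z.1) z.2 = 0 := by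
  have h₀ : 0 < r / 2 := half_pos hr
  have h₁ : r / 2 < r := half_lt_self hr
  rw [Set.mem_prod, not_and_or] at hz
  rcases hz with ht | hx
  · exact newtonFarSmoothing_eq_zero_of_forall h₀.le h₁ fun w _ => hθ _ _ fun h => ht h.1
  · rw [mem_closedBall_zero_iff, not_le] at hx
    refine newtonFarSmoothing_slice_eq_zero_of_lt_norm h₀.le h₁ (R₀ := R₀)
      (fun t y hy => hθ t y fun h => ?_) hx
    exact absurd (mem_closedBall_zero_iff.1 h.2) (not_le.2 hy)

/-- The same for the corrector field `e_{r/2,r}[χ(t)]`. [folklore] -/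
theorem farSmoothingField_slice_eq_zero_of_notMem {χ : ℝ → ℝ³ → ℝ³}
    (hχ : ∀ t y, (t, y) ∉ Icc a b ×ˢ closedBall (0 : ℝ³) R₀ → χ t y = 0) (hr : 0 < r)
    {z : ℝ × ℝ³} (hz : z ∉ Icc a b ×ˢ closedBall (0 : ℝ³) (R₀ + r)) :
    farSmoothingField (r / 2) r (χ z.1) z.2 = 0 := by
  rw [farSmoothingField_apply]
  refine Finset.sum_eq_zero fun i _ => ?_
  rw [newtonFarSmoothing_slice_eq_zero_of_notMem (θ := fun t y => ⟪𝐛 i, χ t y⟫)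
    (fun t y hty => by simp [hχ t y hty]) hr hz, zero_smul]

/-- **Uniform `O(r⁻³)` bound for the corrector** of a space–time test field:
`‖e_{r/2,r}[χ(t)](x)‖ ≤ C/r³`. [folklore] -/
theorem exists_norm_farSmoothingField_slice_le {χ : ℝ → ℝ³ → ℝ³}
    (hχ : IsSpaceTimeTestOn (⊤ : Opens (ℝ × ℝ³)) χ) :
    ∃ C : ℝ, 0 ≤ C ∧ ∀ ⦃r : ℝ⦄, 0 < r → ∀ t x, ‖farSmoothingField (r / 2) r (χ t) x‖ ≤ C / r ^ 3 := by
  have hχi : ∀ i, IsSpaceTimeTestOn (⊤ : Opens (ℝ × ℝ³)) fun t y => ⟪𝐛 i, χ t y⟫ := fun i =>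
    hχ.clm_left (innerSL ℝ (𝐛 i))
  choose C hC0 hC using fun i => exists_abs_newtonFarSmoothing_slice_le (hχi i)
  refine ⟨∑ i, C i, Finset.sum_nonneg fun i _ => hC0 i, fun r hr t x => ?_⟩
  rw [farSmoothingField_apply, Finset.sum_div]
  refine (norm_sum_le _ _).trans (Finset.sum_le_sum fun i _ => ?_)
  rw [norm_smul, (EuclideanSpace.basisFun (Fin 3) ℝ).orthonormal.1 i, mul_one, Real.norm_eq_abs]
  exact hC i hr t x

/-- **Uniform `O(r⁻³)` bound for the convective pairing against the corrector**:
`|⟪v, De_{r/2,r}[ψ(t)](x) v⟫| ≤ ‖v‖² C/r³`. [folklore] -/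
theorem exists_abs_inner_fderiv_farSmoothingField_le {ψ : ℝ → ℝ³ → ℝ³}
    (hψ : IsSpaceTimeTestOn (⊤ : Opens (ℝ × ℝ³)) ψ) :
    ∃ C : ℝ, 0 ≤ C ∧ ∀ ⦃r : ℝ⦄, 0 < r → ∀ t x v,
      |⟪v, fderiv ℝ (farSmoothingField (r / 2) r (ψ t)) x v⟫| ≤ ‖v‖ ^ 2 * (C / r ^ 3) := by
  have hθ : ∀ i j, IsSpaceTimeTestOn (⊤ : Opens (ℝ × ℝ³))
      fun t w => ⟪𝐛 i, fderiv ℝ (ψ t) w (𝐛 j)⟫ := fun i j =>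
    (hψ.fderiv_apply_top (𝐛 j)).clm_left (innerSL ℝ (𝐛 i))
  choose C hC0 hC using fun i j => exists_abs_newtonFarSmoothing_slice_le (hθ i j)
  refine ⟨∑ i, ∑ j, C i j, Finset.sum_nonneg fun i _ => Finset.sum_nonneg fun j _ => hC0 i j,
    fun r hr t x v => ?_⟩
  have hψt : ContDiff ℝ 1 (ψ t) := (hψ.contDiff_slice t).of_le (by norm_cast)
  rw [inner_fderiv_farSmoothingField_apply (half_pos hr) (half_lt_self hr) hψt x v]
  have hvi : ∀ i, |⟪𝐛 i, v⟫| ≤ ‖v‖ := fun i =>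
    (abs_real_inner_le_norm _ _).trans (by rw [(EuclideanSpace.basisFun (Fin 3) ℝ).orthonormal.1 i, one_mul])
  calc |∑ i, ∑ j, ⟪𝐛 i, v⟫ * ⟪𝐛 j, v⟫ *
          newtonFarSmoothing (r / 2) r (fun w => ⟪𝐛 i, fderiv ℝ (ψ t) w (𝐛 j)⟫) x|
      ≤ ∑ i, ∑ j, |⟪𝐛 i, v⟫ * ⟪𝐛 j, v⟫ *
          newtonFarSmoothing (r / 2) r (fun w => ⟪𝐛 i, fderiv ℝ (ψ t) w (𝐛 j)⟫) x| :=
        (Finset.abs_sum_le_sum_abs _ _).trans (Finset.sum_le_sum fun i _ => Finset.abs_sum_le_sum_abs _ _)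
    _ ≤ ∑ i, ∑ j, ‖v‖ ^ 2 * (C i j / r ^ 3) := by
        refine Finset.sum_le_sum fun i _ => Finset.sum_le_sum fun j _ => ?_
        rw [abs_mul, abs_mul, sq]
        exact mul_le_mul (mul_le_mul (hvi i) (hvi j) (abs_nonneg _) (norm_nonneg _))
          (hC i j hr t x) (abs_nonneg _) (by positivity)
    _ = ‖v‖ ^ 2 * ((∑ i, ∑ j, C i j) / r ^ 3) := by
        rw [Finset.sum_div, Finset.mul_sum]
        refine Finset.sum_congr rfl fun i _ => ?_
        rw [Finset.sum_div, Finset.mul_sum]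

/-- Off the box the convective pairing against the corrector vanishes. [folklore] -/
theorem inner_fderiv_farSmoothingField_eq_zero_of_notMem {ψ : ℝ → ℝ³ → ℝ³}
    (hψ : IsSpaceTimeTestOn (⊤ : Opens (ℝ × ℝ³)) ψ)
    (hψ0 : tsupport (uncurry ψ) ⊆ Icc a b ×ˢ closedBall (0 : ℝ³) R₀) (hr : 0 < r)
    {z : ℝ × ℝ³} (hz : z ∉ Icc a b ×ˢ closedBall (0 : ℝ³) (R₀ + r)) (v : ℝ³) :
    ⟪v, fderiv ℝ (farSmoothingField (r / 2) r (ψ z.1)) z.2 v⟫ = 0 := by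
  have hψt : ContDiff ℝ 1 (ψ z.1) := (hψ.contDiff_slice z.1).of_le (by norm_cast)
  rw [inner_fderiv_farSmoothingField_apply (half_pos hr) (half_lt_self hr) hψt z.2 v]
  refine Finset.sum_eq_zero fun i _ => Finset.sum_eq_zero fun j _ => ?_
  rw [newtonFarSmoothing_slice_eq_zero_of_notMem
    (θ := fun t w => ⟪𝐛 i, fderiv ℝ (ψ t) w (𝐛 j)⟫) (fun t y hty => ?_) hr hz, mul_zero]
  simp [IsSpaceTimeTestOn.fderiv_slice_eq_zero_of_notMem (ψ := ψ) fun h => hty (hψ0 h)]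

end RemainderBounds

/-! ### The remainder terms vanish as `r → ∞` -/

section Remainders

variable {S ν : ℝ} {u : ℝ → ℝ³ → ℝ³} {p : ℝ → ℝ³ → ℝ}

/-- The support box of a space–time test field on the slab `(0, S) × ℝ³`: a compact time interval
`[a, b] ⊂ (0, S)` and a ball radius `R₀ ≥ 0`. [folklore] -/
theorem IsSpaceTimeTestOn.exists_tsupport_subset_box (hS : 0 < S) {F : Type*}
    [NormedAddCommGroup F] [NormedSpace ℝ F] {ψ : ℝ → ℝ³ → F}
    (hψ : IsSpaceTimeTestOn (slab ℝ³ (Ioo 0 S) isOpen_Ioo) ψ) :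
    ∃ a b R₀ : ℝ, 0 < a ∧ b < S ∧ 0 ≤ R₀ ∧
      tsupport (uncurry ψ) ⊆ Icc a b ×ˢ closedBall (0 : ℝ³) R₀ := by
  obtain ⟨a, b, ha, -, hb, hsupp⟩ := hψ.exists_time_support_Ioo_slab hS
  obtain ⟨R₀, hR₀, hR⟩ := hψ.exists_forall_eq_zero_of_lt_norm_slice
  refine ⟨a, b, R₀, ha, hb, hR₀, closure_minimal ?_ (isClosed_Icc.prod isClosed_closedBall)⟩
  rintro ⟨t, x⟩ hz
  rw [mem_support] at hz
  refine ⟨?_, ?_⟩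
  · by_contra ht
    exact hz (by simp [uncurry, hsupp t ht])
  · rw [mem_closedBall_zero_iff]
    by_contra hx
    exact hz (hR t x (not_le.1 hx))

/-- `∫∫ |f|^{q}` is finite for `f ∈ L^q`, exponents `3` and `3/2` (bookkeeping). [folklore] -/
theorem lintegral_enorm_rpow_lt_top_of_memLp_three {α : Type*} [MeasurableSpace α] {μ : Measure α}
    {F : Type*} [NormedAddCommGroup F] {f : α → F} (hf : MemLp f 3 μ) :
    ∫⁻ z, ‖f z‖ₑ ^ (3 : ℝ) ∂μ < ⊤ := by
  have h := (eLpNorm_lt_top_iff_lintegral_rpow_enorm_lt_top (by norm_num) (by norm_num)).1 hf.2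
  simpa using h

/-- `∫∫ |f|^{3/2}` is finite for `f ∈ L^{3/2}` (bookkeeping). [folklore] -/
theorem lintegral_enorm_rpow_lt_top_of_memLp_threeHalves {α : Type*} [MeasurableSpace α]
    {μ : Measure α} {F : Type*} [NormedAddCommGroup F] {f : α → F} (hf : MemLp f (3 / 2) μ) :
    ∫⁻ z, ‖f z‖ₑ ^ (3 / 2 : ℝ) ∂μ < ⊤ := by
  have h32 : (3 / 2 : ℝ≥0∞) ≠ 0 := by norm_num
  have h32' : (3 / 2 : ℝ≥0∞) ≠ ⊤ := by
    rw [ENNReal.div_eq_inv_mul]; exact ENNReal.mul_ne_top (by simp) (by simp)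
  have h := (eLpNorm_lt_top_iff_lintegral_rpow_enorm_lt_top h32 h32').1 hf.2
  have e : (3 / 2 : ℝ≥0∞).toReal = 3 / 2 := by
    rw [ENNReal.toReal_div]; norm_num
  rwa [e] at h

/-- Hölder conjugacy of the real exponents `(3/2, 3)`. [folklore] -/
private theorem real_holderConjugate_threeHalves_three : Real.HolderConjugate (3 / 2 : ℝ) 3 :=
  ⟨by norm_num, by norm_num, by norm_num⟩

/-- Hölder conjugacy of the real exponents `(3, 3/2)`. [folklore] -/
private theorem real_holderConjugate_three_threeHalves : Real.HolderConjugate (3 : ℝ) (3 / 2) :=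
  real_holderConjugate_threeHalves_three.symm

/-- **Term A: the pressure against the smoothing remainder of `div ψ` vanishes as `r → ∞`**
(`p ∈ L^{3/2}` of the slab, `|Λ_r[div ψ]| = O(r⁻³)` on a box of volume `O(r³)`). [folklore] -/
theorem tendsto_setIntegral_pressure_mul_farSmoothing (hS : 0 < S)
    (hp : MemLp (uncurry p) (3 / 2) (volume.restrict (Ioo 0 S ×ˢ (univ : Set ℝ³))))
    {ψ : ℝ → ℝ³ → ℝ³} (hψ : IsSpaceTimeTestOn (slab ℝ³ (Ioo 0 S) isOpen_Ioo) ψ) :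
    Tendsto (fun r => ∫ z in Ioo 0 S ×ˢ (univ : Set ℝ³), p z.1 z.2 *
      newtonFarSmoothing (r / 2) r (fun y => VectorCalculus.divergence (ψ z.1) y) z.2) atTop (𝓝 0) := by
  obtain ⟨a, b, R₀, -, -, hR₀, hT⟩ := hψ.exists_tsupport_subset_box hS
  have hg := (hψ.mono le_top).divergence_isSpaceTimeTestOn
  obtain ⟨C, hC0, hC⟩ := exists_abs_newtonFarSmoothing_slice_le hg
  obtain ⟨-, hg0⟩ := hψ.continuous_divergence_field
  have hg0' : ∀ t y, (t, y) ∉ Icc a b ×ˢ closedBall (0 : ℝ³) R₀ →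
      VectorCalculus.divergence (ψ t) y = 0 := fun t y hty => hg0 (t, y) fun h => hty (hT h)
  refine tendsto_setIntegral_slab_of_bound (F := uncurry p) (r₁ := 1) (a := a) (b := b) (C := C)
    real_holderConjugate_threeHalves_three hp.1.aemeasurable.enorm
    (lintegral_enorm_rpow_lt_top_of_memLp_threeHalves hp) hR₀ (fun r hr z _ => ?_) (fun r hr z hz => ?_)
  · rw [norm_mul]
    exact mul_le_mul_of_nonneg_left (hC (one_pos.trans_le hr) z.1 z.2) (norm_nonneg _)
  · rw [newtonFarSmoothing_slice_eq_zero_of_notMem hg0' (one_pos.trans_le hr) hz, mul_zero]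

/-- **Terms B, C, D: the very weak integrand against the corrector `e_r[ψ]` vanishes as `r → ∞`**
(`u ∈ L³` of the slab; `∂ₜe_r = e_r[∂ₜψ]`, `Δe_r = e_r[Δψ]` are `O(r⁻³)` and the convective
pairing is `|u|² O(r⁻³)`, all on a box of volume `O(r³)`). [folklore] -/
theorem tendsto_setIntegral_veryWeakIntegrand_farSmoothingField (hS : 0 < S)
    (hu : MemLp (uncurry u) 3 (volume.restrict (Ioo 0 S ×ˢ (univ : Set ℝ³))))
    {ψ : ℝ → ℝ³ → ℝ³} (hψ : IsSpaceTimeTestOn (slab ℝ³ (Ioo 0 S) isOpen_Ioo) ψ) (ν : ℝ) :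
    Tendsto (fun r => ∫ z in Ioo 0 S ×ˢ (univ : Set ℝ³),
      veryWeakIntegrand ν u (fun t x => farSmoothingField (r / 2) r (ψ t) x) z) atTop (𝓝 0) := by
  obtain ⟨a, b, R₀, -, -, hR₀, hT⟩ := hψ.exists_tsupport_subset_box hS
  have hψ' : IsSpaceTimeTestOn (⊤ : Opens (ℝ × ℝ³)) ψ := hψ.mono le_top
  have hu1 : LocallyIntegrableOn (uncurry u)
      ((slab ℝ³ (Ioo 0 S) isOpen_Ioo : Opens (ℝ × ℝ³)) : Set (ℝ × ℝ³)) volume :=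
    locallyIntegrableOn_slab_of_memLp hu (by norm_num)
  have hu2m := memLp_norm_sq_of_memLp_three hu
  have hu2 : LocallyIntegrableOn (fun z => ‖uncurry u z‖ ^ 2)
      ((slab ℝ³ (Ioo 0 S) isOpen_Ioo : Opens (ℝ × ℝ³)) : Set (ℝ × ℝ³)) volume :=
    locallyIntegrableOn_slab_of_memLp hu2m (by
      rw [ENNReal.le_div_iff_mul_le (Or.inl two_ne_zero) (Or.inl ENNReal.ofNat_ne_top)]; norm_num)
  have hum : AEMeasurable (fun z => ‖uncurry u z‖ₑ) (volume.restrict (Ioo 0 S ×ˢ (univ : Set ℝ³))) :=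
    hu.1.aemeasurable.enorm
  have hu3 := lintegral_enorm_rpow_lt_top_of_memLp_three hu
  -- the derived test fields and their supports
  have hdt := hψ'.timeDeriv_top
  have hlap := hψ'.laplacian_top
  have hdt0 : ∀ t y, (t, y) ∉ Icc a b ×ˢ closedBall (0 : ℝ³) R₀ → timeDeriv ψ t y = 0 :=
    fun t y hty => IsSpaceTimeTestOn.timeDeriv_eq_zero_of_notMem (ψ := ψ) fun h => hty (hT h)
  have hlap0 : ∀ t y, (t, y) ∉ Icc a b ×ˢ closedBall (0 : ℝ³) R₀ → Δ (ψ t) y = 0 :=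
    fun t y hty => laplacian_slice_eq_zero_of_notMem_tsupport fun h => hty (hT h)
  obtain ⟨C₁, hC₁0, hC₁⟩ := exists_norm_farSmoothingField_slice_le hdt
  obtain ⟨C₂, hC₂0, hC₂⟩ := exists_abs_inner_fderiv_farSmoothingField_le hψ'
  obtain ⟨C₃, hC₃0, hC₃⟩ := exists_norm_farSmoothingField_slice_le hlap
  -- the three limits
  have hB : Tendsto (fun r => ∫ z in Ioo 0 S ×ˢ (univ : Set ℝ³),
      ⟪u z.1 z.2, timeDeriv (fun t x => farSmoothingField (r / 2) r (ψ t) x) z.1 z.2⟫) atTop (𝓝 0) := by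
    refine tendsto_setIntegral_slab_of_bound (F := uncurry u) (r₁ := 1) (a := a) (b := b) (C := C₁)
      real_holderConjugate_three_threeHalves hum hu3 hR₀ (fun r hr z _ => ?_) (fun r hr z hz => ?_)
    · have hr0 : 0 < r := one_pos.trans_le hr
      rw [timeDeriv_farSmoothingField (half_pos hr0) (half_lt_self hr0) hψ']
      exact (norm_inner_le_norm _ _).trans (mul_le_mul_of_nonneg_left (hC₁ hr0 _ _) (norm_nonneg _))
    · have hr0 : 0 < r := one_pos.trans_le hr
      rw [timeDeriv_farSmoothingField (half_pos hr0) (half_lt_self hr0) hψ',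
        farSmoothingField_slice_eq_zero_of_notMem hdt0 hr0 hz, inner_zero_right]
  have hC : Tendsto (fun r => ∫ z in Ioo 0 S ×ˢ (univ : Set ℝ³),
      ⟪u z.1 z.2, convect (u z.1) (fun x => farSmoothingField (r / 2) r (ψ z.1) x) z.2⟫) atTop (𝓝 0) := by
    refine tendsto_setIntegral_slab_of_bound (F := fun z => ‖uncurry u z‖ ^ 2) (r₁ := 1) (a := a)
      (b := b) (C := C₂) real_holderConjugate_threeHalves_three hu2m.1.aemeasurable.enorm
      (lintegral_enorm_rpow_lt_top_of_memLp_threeHalves hu2m) hR₀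
      (fun r hr z _ => ?_) (fun r hr z hz => ?_)
    · have hr0 : 0 < r := one_pos.trans_le hr
      rw [convect, Real.norm_eq_abs]
      refine (hC₂ hr0 z.1 z.2 (u z.1 z.2)).trans (le_of_eq ?_)
      simp [uncurry]
    · have hr0 : 0 < r := one_pos.trans_le hr
      exact inner_fderiv_farSmoothingField_eq_zero_of_notMem hψ' hT hr0 hz _
  have hD : Tendsto (fun r => ∫ z in Ioo 0 S ×ˢ (univ : Set ℝ³),
      ν * ⟪u z.1 z.2, Δ (fun x => farSmoothingField (r / 2) r (ψ z.1) x) z.2⟫) atTop (𝓝 0) := by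
    refine tendsto_setIntegral_slab_of_bound (F := uncurry u) (r₁ := 1) (a := a) (b := b)
      (C := |ν| * C₃) real_holderConjugate_three_threeHalves hum hu3 hR₀ (fun r hr z _ => ?_)
      (fun r hr z hz => ?_)
    · have hr0 : 0 < r := one_pos.trans_le hr
      have hψ2 : ContDiff ℝ 2 (ψ z.1) := (hψ.contDiff_slice z.1).of_le (by norm_cast)
      rw [show (fun x => farSmoothingField (r / 2) r (ψ z.1) x) = farSmoothingField (r / 2) r (ψ z.1)
        from rfl, laplacian_farSmoothingField (half_pos hr0) (half_lt_self hr0) hψ2, norm_mul,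
        Real.norm_eq_abs, mul_div_assoc, mul_left_comm]
      refine mul_le_mul_of_nonneg_left ?_ (abs_nonneg _)
      exact (norm_inner_le_norm _ _).trans (mul_le_mul_of_nonneg_left (hC₃ hr0 _ _) (norm_nonneg _))
    · have hr0 : 0 < r := one_pos.trans_le hr
      have hψ2 : ContDiff ℝ 2 (ψ z.1) := (hψ.contDiff_slice z.1).of_le (by norm_cast)
      rw [show (fun x => farSmoothingField (r / 2) r (ψ z.1) x) = farSmoothingField (r / 2) r (ψ z.1)
        from rfl, laplacian_farSmoothingField (half_pos hr0) (half_lt_self hr0) hψ2,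
        farSmoothingField_slice_eq_zero_of_notMem hlap0 hr0 hz, inner_zero_right, mul_zero]
  -- assembling: for `r > 0` the integral splits
  have hsum := (hB.add hC).add hD
  rw [add_zero, add_zero] at hsum
  refine hsum.congr' ?_
  filter_upwards [eventually_gt_atTop 0] with r hr
  have he := isSpaceTimeTestOn_farSmoothingField_slab hS hψ (half_pos hr) (half_lt_self hr)
  obtain ⟨I1, I2, I3⟩ := integrable_veryWeak_terms hu1 hu2 he ν
  simp only [veryWeakIntegrand_apply]
  rw [integral_add (f := fun z : ℝ × ℝ³ =>
      ⟪u z.1 z.2, timeDeriv (fun t x => farSmoothingField (r / 2) r (ψ t) x) z.1 z.2⟫ +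
        ⟪u z.1 z.2, convect (u z.1) (fun x => farSmoothingField (r / 2) r (ψ z.1) x) z.2⟫)
      (g := fun z : ℝ × ℝ³ => ν * ⟪u z.1 z.2, Δ (fun x => farSmoothingField (r / 2) r (ψ z.1) x) z.2⟫)
      (I1.integrableOn.add I2.integrableOn) I3.integrableOn,
    integral_add I1.integrableOn I2.integrableOn]

end Remainders

/-! ### The main theorem -/

section Main

variable {S ν : ℝ} {u : ℝ → ℝ³ → ℝ³} {p : ℝ → ℝ³ → ℝ}

/-- **Very weak `L³` solutions with the Riesz pressure are distributional solutions**
(Lemarié-Rieusset 2016, Ch. 6: Def. 6.2 (very weak solutions, (6.2)), Lemma 6.3 and (6.13) (the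
pressure as a distribution), Prop. 6.5 with Def. 6.9 and Lemma 6.4 (B) (a very weak solution in
`L²((0,T), L²((1+|x|)⁻⁴dx))` is an Oseen solution: `∇p = -(Id - ℙ) div(u ⊗ u)`), realised here
with compactly supported objects only). Let `u ∈ L³((0,S) × ℝ³)` and `p ∈ L^{3/2}((0,S) × ℝ³)`
satisfy, on the open slab `Q = (0, S) × ℝ³`: `div u = 0` weakly (`∫∫_Q ⟪u, ∇θ⟫ = 0`), the weak
pressure Poisson equation `∫∫_Q p Δθ = -∫∫_Q D²θ(u, u)` (`-Δp = ∂ᵢ∂ⱼ(uᵢuⱼ)`, i.e. `p` is the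
Riesz pressure `Σ ℛᵢℛⱼ(uᵢuⱼ)` slice-wise), and the very weak (pressure-free) momentum equation
`∫∫_Q ⟪u, ∂ₜψ⟫ + ⟪u, (u·∇)ψ⟫ + ν⟪u, Δψ⟫ = 0` for every test field `ψ ∈ C_c^∞(Q; ℝ³)` with
divergence-free slices. Then `(u, p)` is a distributional solution of the unforced Navier–Stokes
equations on `Q` (`IsDistributionalNSSolutionOn`). Proof: for a general test field `ψ` and
`r > 0`, `w_r = ψ - ∇N_{r/2,r}[div ψ] - e_{r/2,r}[ψ]` is an admissible divergence-free test field
(`correctedTestField`); the gradient part contributes exactly `-∫∫ p Δ N[div ψ] =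
-∫∫ p div ψ + ∫∫ p Λ_r[div ψ]`, and the remainder terms are `O(r⁻¹)` (`O(r⁻²)`), so `r → ∞`
gives the pressure-explicit identity. [cite: LemarieRieusset2016, Def. 6.2 with Lemma 6.3 (file p. 126), (6.13) (p. 135), Prop. 6.5 with Def. 6.9 (p. 136)] -/
theorem isDistributionalNSSolutionOn_slab_of_veryWeak
    (hu : MemLp (uncurry u) 3 (volume.restrict (Ioo 0 S ×ˢ (univ : Set ℝ³))))
    (hp : MemLp (uncurry p) (3 / 2) (volume.restrict (Ioo 0 S ×ˢ (univ : Set ℝ³))))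
    (hdiv : ∀ θ : ℝ → ℝ³ → ℝ, IsSpaceTimeTestOn (slab ℝ³ (Ioo 0 S) isOpen_Ioo) θ →
      ∫ z in Ioo 0 S ×ˢ (univ : Set ℝ³), ⟪u z.1 z.2, gradient (θ z.1) z.2⟫ = 0)
    (hpois : ∀ θ : ℝ → ℝ³ → ℝ, IsSpaceTimeTestOn (slab ℝ³ (Ioo 0 S) isOpen_Ioo) θ →
      ∫ z in Ioo 0 S ×ˢ (univ : Set ℝ³), p z.1 z.2 * Δ (θ z.1) z.2 =
        -∫ z in Ioo 0 S ×ˢ (univ : Set ℝ³), fderiv ℝ (fderiv ℝ (θ z.1)) z.2 (u z.1 z.2) (u z.1 z.2))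
    (hweak : ∀ ψ : ℝ → ℝ³ → ℝ³, IsSpaceTimeTestOn (slab ℝ³ (Ioo 0 S) isOpen_Ioo) ψ →
      (∀ t, VectorCalculus.IsDivFree (ψ t)) →
      ∫ z in Ioo 0 S ×ˢ (univ : Set ℝ³), (⟪u z.1 z.2, timeDeriv ψ z.1 z.2⟫ +
        ⟪u z.1 z.2, convect (u z.1) (ψ z.1) z.2⟫ + ν * ⟪u z.1 z.2, Δ (ψ z.1) z.2⟫) = 0) :
    IsDistributionalNSSolutionOn (slab ℝ³ (Ioo 0 S) isOpen_Ioo) ν 0 u p := by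
  have hQ : ((slab ℝ³ (Ioo 0 S) isOpen_Ioo : Opens (ℝ × ℝ³)) : Set (ℝ × ℝ³)) =
      Ioo 0 S ×ˢ (univ : Set ℝ³) := rfl
  have hu1 : LocallyIntegrableOn (uncurry u)
      ((slab ℝ³ (Ioo 0 S) isOpen_Ioo : Opens (ℝ × ℝ³)) : Set (ℝ × ℝ³)) volume :=
    locallyIntegrableOn_slab_of_memLp hu (by norm_num)
  have hu2 : LocallyIntegrableOn (fun z => ‖uncurry u z‖ ^ 2)
      ((slab ℝ³ (Ioo 0 S) isOpen_Ioo : Opens (ℝ × ℝ³)) : Set (ℝ × ℝ³)) volume :=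
    locallyIntegrableOn_slab_of_memLp (memLp_norm_sq_of_memLp_three hu) (by
      rw [ENNReal.le_div_iff_mul_le (Or.inl two_ne_zero) (Or.inl ENNReal.ofNat_ne_top)]; norm_num)
  have hp1 : LocallyIntegrableOn (uncurry p)
      ((slab ℝ³ (Ioo 0 S) isOpen_Ioo : Opens (ℝ × ℝ³)) : Set (ℝ × ℝ³)) volume :=
    locallyIntegrableOn_slab_of_memLp hp (by
      rw [ENNReal.le_div_iff_mul_le (Or.inl two_ne_zero) (Or.inl ENNReal.ofNat_ne_top)]; norm_num)
  refine ⟨hu1, hu2, hp1, fun θ hθ => hdiv θ hθ, fun ψ hψ => ?_⟩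
  rw [hQ]
  -- the degenerate slab
  rcases le_or_gt S 0 with hS | hS
  · rw [Ioo_eq_empty_of_le hS, empty_prod, Measure.restrict_empty, integral_zero_measure]
  -- notation
  set g : ℝ → ℝ³ → ℝ := fun t x => VectorCalculus.divergence (ψ t) x with hg_def
  have hg : IsSpaceTimeTestOn (slab ℝ³ (Ioo 0 S) isOpen_Ioo) g := hψ.divergence_isSpaceTimeTestOn
  -- the target integrand is `W(ψ) + p g`
  have hint : ∀ z : ℝ × ℝ³, ⟪u z.1 z.2, timeDeriv ψ z.1 z.2⟫ + ⟪u z.1 z.2, convect (u z.1) (ψ z.1) z.2⟫ +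
      ν * ⟪u z.1 z.2, Δ (ψ z.1) z.2⟫ + p z.1 z.2 * VectorCalculus.divergence (ψ z.1) z.2 +
      ⟪(0 : ℝ → ℝ³ → ℝ³) z.1 z.2, ψ z.1 z.2⟫ = veryWeakIntegrand ν u ψ z + p z.1 z.2 * g z.1 z.2 := by
    intro z
    simp only [veryWeakIntegrand_apply, hg_def, Pi.zero_apply, inner_zero_left, add_zero]
  simp_rw [hint]
  -- integrability of `W(ψ)` and `p g`
  have IW := integrable_veryWeakIntegrand hu1 hu2 hψ ν
  obtain ⟨cg, hg0⟩ := hψ.continuous_divergence_field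
  have Ipg : Integrable (fun z : ℝ × ℝ³ => p z.1 z.2 * g z.1 z.2) (volume : Measure (ℝ × ℝ³)) :=
    integrable_mul_of_locallyIntegrableOn (F := uncurry p) hp1 cg hψ.hasCompactSupport
      hψ.tsupport_subset hg0
  rw [integral_add IW.integrableOn Ipg.integrableOn]
  -- the key identity at scale `r > 0`
  have key : ∀ r : ℝ, 0 < r →
      (∫ z in Ioo 0 S ×ˢ (univ : Set ℝ³), veryWeakIntegrand ν u ψ z) +
        ∫ z in Ioo 0 S ×ˢ (univ : Set ℝ³), p z.1 z.2 * g z.1 z.2 =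
      (∫ z in Ioo 0 S ×ˢ (univ : Set ℝ³), p z.1 z.2 * newtonFarSmoothing (r / 2) r (g z.1) z.2) +
        ∫ z in Ioo 0 S ×ˢ (univ : Set ℝ³),
          veryWeakIntegrand ν u (fun t x => farSmoothingField (r / 2) r (ψ t) x) z := by
    intro r hr
    have h₀ : 0 < r / 2 := half_pos hr
    have h₁ : r / 2 < r := half_lt_self hr
    -- the pieces of `w_r`
    have hφ : IsSpaceTimeTestOn (slab ℝ³ (Ioo 0 S) isOpen_Ioo)
        (fun t => newtonNearPotential (r / 2) r (g t)) := hg.newtonNearPotential_slab hS h₀.le h₁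
    have hΛ : IsSpaceTimeTestOn (slab ℝ³ (Ioo 0 S) isOpen_Ioo)
        (fun t => newtonFarSmoothing (r / 2) r (g t)) := hg.newtonFarSmoothing_slab hS h₀ h₁
    have hgradφ := hφ.gradient_isSpaceTimeTestOn
    have he := isSpaceTimeTestOn_farSmoothingField_slab hS hψ h₀ h₁
    have hw := isSpaceTimeTestOn_correctedTestField hS hψ hr
    -- `hweak` for `w_r`, split into three integrals
    have hzero := hweak (correctedTestField r ψ) hw (isDivFree_correctedTestField hψ hr)
    have hsplit : ∀ z : ℝ × ℝ³, ⟪u z.1 z.2, timeDeriv (correctedTestField r ψ) z.1 z.2⟫ +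
        ⟪u z.1 z.2, convect (u z.1) (correctedTestField r ψ z.1) z.2⟫ +
        ν * ⟪u z.1 z.2, Δ (correctedTestField r ψ z.1) z.2⟫ =
        veryWeakIntegrand ν u ψ z -
          veryWeakIntegrand ν u (fun t x => gradient (newtonNearPotential (r / 2) r (g t)) x) z -
          veryWeakIntegrand ν u (fun t x => farSmoothingField (r / 2) r (ψ t) x) z := by
      intro z
      rw [← veryWeakIntegrand_apply, ← veryWeakIntegrand_sub hψ hgradφ z,
        ← veryWeakIntegrand_sub (hψ.sub hgradφ) he z]
      rfl
    simp_rw [hsplit] at hzero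
    have IW1 := integrable_veryWeakIntegrand hu1 hu2 hgradφ ν
    have IW2 := integrable_veryWeakIntegrand hu1 hu2 he ν
    rw [integral_sub (f := fun z => veryWeakIntegrand ν u ψ z -
        veryWeakIntegrand ν u (fun t x => gradient (newtonNearPotential (r / 2) r (g t)) x) z)
        (g := veryWeakIntegrand ν u (fun t x => farSmoothingField (r / 2) r (ψ t) x))
        (IW.integrableOn.sub IW1.integrableOn) IW2.integrableOn,
      integral_sub IW.integrableOn IW1.integrableOn] at hzero
    have hG := setIntegral_veryWeakIntegrand_gradient (ν := ν) hu1 hu2 hdiv hpois hφ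
    rw [hQ] at hG
    rw [hG] at hzero
    -- the pressure against `ΔN[g] = g - Λ[g]`
    obtain ⟨cΛ, hΛ0'⟩ := (show Continuous (uncurry fun t => newtonFarSmoothing (r / 2) r (g t)) ∧
        ∀ z : ℝ × ℝ³, z ∉ tsupport (uncurry fun t => newtonFarSmoothing (r / 2) r (g t)) →
          newtonFarSmoothing (r / 2) r (g z.1) z.2 = 0 from
      ⟨hΛ.contDiff.continuous, fun z hz =>
        show uncurry (fun t => newtonFarSmoothing (r / 2) r (g t)) z = 0 from
          image_eq_zero_of_notMem_tsupport hz⟩)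
    have IpΛ : Integrable (fun z : ℝ × ℝ³ => p z.1 z.2 * newtonFarSmoothing (r / 2) r (g z.1) z.2)
        (volume : Measure (ℝ × ℝ³)) :=
      integrable_mul_of_locallyIntegrableOn (F := uncurry p) hp1 cΛ hΛ.hasCompactSupport
        hΛ.tsupport_subset hΛ0'
    have hlapN : ∀ z : ℝ × ℝ³, p z.1 z.2 * Δ (newtonNearPotential (r / 2) r (g z.1)) z.2 =
        p z.1 z.2 * g z.1 z.2 - p z.1 z.2 * newtonFarSmoothing (r / 2) r (g z.1) z.2 := by
      intro z
      rw [laplacian_newtonNearPotential h₀ h₁ ((hg.contDiff_slice z.1).of_le (by norm_cast)), mul_sub]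
    simp_rw [hlapN] at hzero
    rw [integral_sub Ipg.integrableOn IpΛ.integrableOn] at hzero
    linarith
  -- the remainder vanishes
  have hlim := (tendsto_setIntegral_pressure_mul_farSmoothing hS hp hψ).add
    (tendsto_setIntegral_veryWeakIntegrand_farSmoothingField hS hu hψ ν)
  rw [add_zero] at hlim
  have hconst : Tendsto (fun _ : ℝ => (∫ z in Ioo 0 S ×ˢ (univ : Set ℝ³), veryWeakIntegrand ν u ψ z) +
      ∫ z in Ioo 0 S ×ˢ (univ : Set ℝ³), p z.1 z.2 * g z.1 z.2) atTop (𝓝 0) := by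
    refine hlim.congr' ?_
    filter_upwards [eventually_gt_atTop 0] with r hr
    exact (key r hr).symm
  exact tendsto_nhds_unique tendsto_const_nhds hconst

end Main

end Literature.Analysis.FluidPDE
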